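import Summits.ValiantsHypothesis.ValiantsHypothesis.Theses.NewtonUnitEquations
import Summits.ValiantsHypothesis.ValiantsHypothesis.Cruxes.TwoProducts.RankThreeWronskian_val_idea_35_g10
import Mathlib.Data.Finsupp.Lex
import Mathlib.RingTheory.MvPolynomial.EulerIdentity
import Mathlib.GroupTheory.Archimedean
import Summits.ValiantsHypothesis.ValiantsHypothesis.Theorems.TwoProducts.RankThreeWronskianTowerLevels
import Summits.ValiantsHypothesis.ValiantsHypothesis.Theorems.TwoProducts.RankThreeWronskianTower
import Summits.ValiantsHypothesis.ValiantsHypothesis.Theorems.TwoProducts.RankThreeAffineBinomial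
import Summits.ValiantsHypothesis.ValiantsHypothesis.Theorems.TwoProducts.RankTwoJacobianTower
import Summits.ValiantsHypothesis.ValiantsHypothesis.Theorems.TwoProducts.Negative.EscapeAccounting
import Literature.RingTheory.MvPolynomial.BinaryFormLinearFactors

/-! # RankThreeLattice (val-idea-35 g11) — TRANCHE B of the `LevelOneLaw` kernel: the RELATION LATTICE of an NC arc is CYCLIC, and PROGRESSION DATA EXIST

Companion workfile of `Cruxes/TwoProducts/RankThreeWronskian_val_idea_35_g10.lean` (REV 8, which is at the 200 000-byte cap of `ledger crux write`;
Cruxes modules are not built on the farm, so this file cannot import that one and is STANDALONE: the five vocabulary lines `Poly2 / Poly3 / Expo /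
idet / piv` below are VERBATIM copies of that file's, hence definitionally equal to them).

WHAT IS PROVED HERE (fully proved, std axioms pinned): for a pivot triple `p : Fin 3 → Expo` that is not a ray triple
(`hnc : ¬(idet p₀ p₁ = 0 ∧ idet p₀ p₂ = 0 ∧ idet p₁ p₂ = 0)` — `NoRayTriple w` of the main file read at the `ν`-tops):
* `exists_injective_coord`: some coordinate is injective on `Λ_p = {c ∈ ℤ³ : Σ cᵢ pᵢ = 0}` (2×2 Cramer elimination, three cases);
* ★ `relLattice_cyclic`: `Λ_p = ℤ·c₀` (`Int.subgroup_cyclic` on the injective coordinate's image); `genRel p` := a chosen generator,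
  `zpos / zneg` its positive / negative parts (disjoint supports), `piv_zpos_eq : piv p (zpos c) = piv p (zneg c)` for `c ∈ Λ_p`;
* ★★ `exists_progData`: for `deg P ≤ m`, every fibre of `π_p` on `supp P` is a progression `α = base(π α) + (idx α)·(zpos c₀ − zneg c₀)`, `idx α ≤ m`.
These are LITERALLY the hypotheses `cp := zpos (genRel p)`, `cm := zneg (genRel p)`, `J := m`, `base`, `idx`, `hrel := piv_zpos_eq`, `hidx`, `hprog`
of the main file's per-direction level-1 top theorem `levelOne_not_isEdgeDir` (REV 7, TRANCHE A).  THE COMPOSITION (TRANCHE A ⧺ B) is the 12-line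
proof below, KERNEL-CHECKED in the single-file draft `pub/ideators/val-idea-35/g11/RankThreeWronskian-g11-rev9.lean` (sha16 9b6cb09563170788, farm
rc 0, nothing admitted; read by val-idea-crit-8 g5, VERDICT #91) and to be typed where both files are importable (TRANCHE C's home):
```
def arcBinomial (w : Fin 3 → Poly2) (p : Fin 3 → Expo) : Poly2 :=
  mono w (zpos (genRel p)) - C (coeff (piv p (zpos (genRel p))) (mono w (zpos (genRel p))) /
    coeff (piv p (zpos (genRel p))) (mono w (zneg (genRel p)))) * mono w (zneg (genRel p))
theorem levelOne_not_isEdgeDir_nc {ν} (w P p) (m : ℕ) (hP : P.totalDegree ≤ m) (hNR : NoRayTriple w)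
    (hw : ∀ i, IsUniqueTop ν (w i) (p i)) (hN : ¬ IsEdgeDir ν (arcBinomial w p))
    (hNFC : ∀ q q' e, ¬ FibreCoincidence w P ν p q q' e) (hgen : …) : ¬ IsEdgeDir ν (aeval w P) := by
  have hnc := hNR (p 0) (hw 0).1 (p 1) (hw 1).1 (p 2) (hw 2).1
  obtain ⟨base, idx, hidx, hprog⟩ := exists_progData P m hP p hnc
  have hrel := piv_zpos_eq p (genRel_spec p hnc).1
  by_cases hN0 : arcBinomial w p = 0
  · exact levelOne_not_isEdgeDir w P p hw _ _ m base idx hrel hidx hprog 0 (Or.inl hN0) hNFC hgen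
  · obtain ⟨E, hE⟩ := exists_isUniqueTop_of_not_isEdgeDir hN0 hN
    exact levelOne_not_isEdgeDir w P p hw _ _ m base idx hrel hidx hprog E (Or.inr hE) hNFC hgen
```
(remark of record, crit-8 #91: `arcBinomial` divides by the `c⁻`-top coefficient — junk-safe since `hN` is a hypothesis, but TRANCHE C must show
that coefficient `≠ 0` under `hw` when it discharges `hN` by the T1-A count ✓ `RankThreeAffineBinomial`.)
LABELS: ★★ kernel pieces of the level-1 («easy envelope») law — lattice hypotheses CONSTRUCTED; `LevelOneLaw` still carries NFC + TRANCHE C's direction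
bookkeeping, typed OPEN in the main file; `OLMLaw` / `RankThreeAffineLaw(Exp)` / `TwoProducts` (5906) / PCB / `ResidualLawV25` UNMOVED; side-ladder;
0 summit distance; VP ≠ VNP is NOT proved. -/

/-! ## REV 2 (val-idea-35 g11, director-valiant R468 / crit-8 g5 #101, #104, #105): TRANCHE C — `LevelOneLaw ⟸ PerDirLevelOne` (memo §16)

`section TrancheC` below states the ONE hypothesis shape `PerDirLevelOne` (= literally the ∀-closed statement of the A⧺B composition
`levelOne_not_isEdgeDir_nc`, in the ✓ Theorems vocabulary `…Theorems.TwoProducts.RankTwoJacobian.{nv, wt, IsEdgeDir, IsUniqueTop, dir, Eset, X3, S3,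
OnArc, idx3, Ef, Tset, S1, TieIn}` — opened NAME BY NAME, nothing else restated — over this file's own `Poly2/Poly3/Expo/idet/piv` and VERBATIM copies
of the main workfile's `NoRayTriple` (l.2985), `fibre` (l.2993), `fibrePart` (l.2997), `FibreCoincidence` (l.3037), `NFC` (l.3043), `LevelOneLaw`
(l.3052), `mono`/`mono_add`/`mono_nsmul`/`aeval_monomial_eq` (l.3203–3218) and HOME rev9's `arcBinomial`), and PROVES, kernel-checked and with no
unfinished proof anywhere in the file: the per-arc C-COVER `Ef_subset_of_perDir` (memo 16.2: on arc `b`, every edge parameter of `D = aeval w P` is an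
edge parameter of the arc binomial or a weight coincidence of two candidate fibre tops), the pair count `card_coinc_le` (16.3 (iii)), the relation-
binomial count `card_Eset_relBinomial_le` (16.3 (ii): sign pattern of the primitive relation + ✓ T1-A `card_Eset_binomialAffine_le` at a rotation of
the letters), the fibre-part count `card_Eset_fibrePart_le` (16.4 F-SPLIT: ✓ Literature `exists_C_mul_prod_linear_of_isHomogeneous` + ✓
`isEdgeDir_mul_left` + ✓ `Eset_mul_subset`), the constant-letter branch `nv_le_of_constLetter` (16.5: ✓ `eq_C_of_S1_empty` + ✓ `rankTwoCrudeBound`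
via `bind₁`), the chart split, the closing arithmetic, and the ★★ assembly `levelOneLaw_of_perDir : PerDirLevelOne → LevelOneLaw` with `c = 40`.
CUT 1 of this REV (59f702c857a8c676, crit-8 #105) was the statements-first skeleton with five open bricks; this cut closes all five.
LABEL (crit-8 #101/#104): ★★ bookkeeping closure of the typed-OPEN `LevelOneLaw` modulo the A⧺B glue's home (`PerDirLevelOne` is DISCHARGED by
TRANCHE A `levelOne_not_isEdgeDir` (main workfile) + TRANCHE B `exists_progData` (this file) + the rev9 glue as soon as one file may import both —
operator question b201) = first poly(m,t) cell with unbounded column count UNDER NFC; easy envelope; 0 summit distance; NOT (γ); `OLMLaw` at `K → ∞`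
remains the residue; `TwoProducts` is UNMOVED; VP ≠ VNP is NOT proved. -/

/-! ## REV 3 (val-idea-35 g11; director-valiant R476 / b203, crit-8 g5 #106): `PerDirLevelOne` DISCHARGED ⇒ `LevelOneLaw` CLOSED IN THE TREE

With the main workfile importable (b203: `import …Cruxes.TwoProducts.RankThreeWronskian_val_idea_35_g10`, Cruxes → Cruxes, acyclic — that file
imports no companion), `section ClosureB203` at the end composes TRANCHE A (the main file's ✓ `ValIdea35g10.levelOne_not_isEdgeDir` and ✓
`ValIdea35g10.exists_isUniqueTop_of_not_isEdgeDir`, cited BY NAME, nothing restated) with TRANCHE B (★★ `exists_progData`, this file) exactly as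
the 12-line HOME rev9 glue `levelOne_not_isEdgeDir_nc` (9b6cb09563170788 l.3871–3883) did: `perDirLevelOne_holds : PerDirLevelOne`, hence
`levelOneLaw_holds : LevelOneLaw`, and — the copy being definitionally the main file's (`levelOneLaw_eq_main : LevelOneLaw = ValIdea35g10.LevelOneLaw
:= rfl`, crit-8's dictionary check T-c) — `main_levelOneLaw : ValIdea35g10.LevelOneLaw`.  Also crit-8's #106 nit (`totalDegree_bind₁_le_of_le_one'`
is now `private`).  LABEL unchanged in kind: `LevelOneLaw` = the easy envelope WITH NFC (first poly(m,t) cell with unbounded column count), now a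
tree theorem outright; NOT (γ); `OLMLaw` at `K → ∞` / merged resonances remains the residue of rung 3-AFF; `TwoProducts` UNMOVED; VP ≠ VNP NOT proved. -/

noncomputable section
set_option linter.dupNamespace false

namespace Summit.ValiantsHypothesis.ValiantsHypothesis.Cruxes.TwoProducts.ValIdea35g11Lattice

open scoped BigOperators
open MvPolynomial

/-! ### vocabulary (verbatim from `RankThreeWronskian_val_idea_35_g10.lean`) -/
abbrev Poly2 := MvPolynomial (Fin 2) ℂ
abbrev Poly3 := MvPolynomial (Fin 3) ℂ
abbrev Expo := Fin 2 →₀ ℕ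
/-- integer determinant of two exponents (verbatim g9) -/
def idet (γ s : Fin 2 →₀ ℕ) : ℤ := ((γ 0 : ℕ) : ℤ) * ((s 1 : ℕ) : ℤ) - ((γ 1 : ℕ) : ℤ) * ((s 0 : ℕ) : ℤ)
/-- the pivot map `π_p(α) = Σᵢ αᵢ • pᵢ` (top exponent of `w^α` when `pᵢ` is the unique top of `wᵢ`) -/
def piv (p : Fin 3 → Expo) (α : Fin 3 →₀ ℕ) : Expo := ∑ i, (α i) • p i

section LatticeG11
open scoped Classical

/-- the ℤ-linear extension of the pivot map `π_p` to `ℤ³ → ℤ²` -/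
def zpiv (p : Fin 3 → Expo) (c : Fin 3 → ℤ) : Fin 2 → ℤ := fun l => ∑ k, c k * ((p k l : ℕ) : ℤ)

theorem zpiv_add (p : Fin 3 → Expo) (c c' : Fin 3 → ℤ) : zpiv p (c + c') = zpiv p c + zpiv p c' := by
  funext l
  simp only [zpiv, Pi.add_apply, add_mul, Finset.sum_add_distrib]

theorem zpiv_zsmul (p : Fin 3 → Expo) (n : ℤ) (c : Fin 3 → ℤ) : zpiv p (n • c) = n • zpiv p c := by
  funext l
  simp only [zpiv, Pi.smul_apply, smul_eq_mul, mul_assoc, Finset.mul_sum]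

/-- the RELATION LATTICE `Λ_p = {c ∈ ℤ³ : Σ_k c_k p_k = 0}` -/
def relLattice (p : Fin 3 → Expo) : AddSubgroup (Fin 3 → ℤ) where
  carrier := {c | zpiv p c = 0}
  add_mem' := by
    intro a b ha hb
    simp only [Set.mem_setOf_eq] at ha hb ⊢
    rw [zpiv_add, ha, hb, add_zero]
  zero_mem' := by
    simp only [Set.mem_setOf_eq]
    funext l; simp [zpiv]
  neg_mem' := by
    intro a ha
    simp only [Set.mem_setOf_eq] at ha ⊢
    have : -a = (-1 : ℤ) • a := by simp
    rw [this, zpiv_zsmul, ha, smul_zero]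

theorem mem_relLattice {p : Fin 3 → Expo} {c : Fin 3 → ℤ} : c ∈ relLattice p ↔ zpiv p c = 0 := Iff.rfl

theorem zsmul_mem_relLattice {p : Fin 3 → Expo} {c : Fin 3 → ℤ} (hc : c ∈ relLattice p) (n : ℤ) : n • c ∈ relLattice p := by
  rw [mem_relLattice] at hc ⊢
  rw [zpiv_zsmul, hc, smul_zero]

/-- the two coordinate equations of a relation, spelled out -/
theorem rel_eqs {p : Fin 3 → Expo} {c : Fin 3 → ℤ} (hc : c ∈ relLattice p) (l : Fin 2) :
    c 0 * ((p 0 l : ℕ) : ℤ) + c 1 * ((p 1 l : ℕ) : ℤ) + c 2 * ((p 2 l : ℕ) : ℤ) = 0 := by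
  have h := congrFun (mem_relLattice.mp hc) l
  simp only [zpiv, Fin.sum_univ_three, Pi.zero_apply] at h
  exact h

/-- NC ARC ⇒ SOME COORDINATE IS INJECTIVE ON THE LATTICE: if not all three pivot pairs are parallel, there is a letter `k` such that a
relation with `c_k = 0` is trivial. -/
theorem exists_injective_coord (p : Fin 3 → Expo)
    (hnc : ¬ (idet (p 0) (p 1) = 0 ∧ idet (p 0) (p 2) = 0 ∧ idet (p 1) (p 2) = 0)) :
    ∃ k : Fin 3, ∀ c ∈ relLattice p, c k = 0 → c = 0 := by
  by_cases h01 : idet (p 0) (p 1) = 0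
  · by_cases h02 : idet (p 0) (p 2) = 0
    · have h12 : idet (p 1) (p 2) ≠ 0 := fun h => hnc ⟨h01, h02, h⟩
      refine ⟨0, fun c hc hk => ?_⟩
      have e0 := rel_eqs hc 0
      have e1 := rel_eqs hc 1
      rw [hk, zero_mul, zero_add] at e0 e1
      have h1 : c 1 * idet (p 1) (p 2) = 0 := by unfold idet; linear_combination ((p 2 1 : ℕ) : ℤ) * e0 - ((p 2 0 : ℕ) : ℤ) * e1
      have h2 : c 2 * idet (p 1) (p 2) = 0 := by unfold idet; linear_combination ((p 1 0 : ℕ) : ℤ) * e1 - ((p 1 1 : ℕ) : ℤ) * e0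
      have hc1 : c 1 = 0 := (mul_eq_zero.mp h1).resolve_right h12
      have hc2 : c 2 = 0 := (mul_eq_zero.mp h2).resolve_right h12
      funext i; fin_cases i <;> simp [hk, hc1, hc2]
    · refine ⟨1, fun c hc hk => ?_⟩
      have e0 := rel_eqs hc 0
      have e1 := rel_eqs hc 1
      rw [hk, zero_mul, add_zero] at e0 e1
      have h0 : c 0 * idet (p 0) (p 2) = 0 := by unfold idet; linear_combination ((p 2 1 : ℕ) : ℤ) * e0 - ((p 2 0 : ℕ) : ℤ) * e1
      have h2 : c 2 * idet (p 0) (p 2) = 0 := by unfold idet; linear_combination ((p 0 0 : ℕ) : ℤ) * e1 - ((p 0 1 : ℕ) : ℤ) * e0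
      have hc0 : c 0 = 0 := (mul_eq_zero.mp h0).resolve_right h02
      have hc2 : c 2 = 0 := (mul_eq_zero.mp h2).resolve_right h02
      funext i; fin_cases i <;> simp [hk, hc0, hc2]
  · refine ⟨2, fun c hc hk => ?_⟩
    have e0 := rel_eqs hc 0
    have e1 := rel_eqs hc 1
    rw [hk, zero_mul, add_zero] at e0 e1
    have h0 : c 0 * idet (p 0) (p 1) = 0 := by unfold idet; linear_combination ((p 1 1 : ℕ) : ℤ) * e0 - ((p 1 0 : ℕ) : ℤ) * e1
    have h1 : c 1 * idet (p 0) (p 1) = 0 := by unfold idet; linear_combination ((p 0 0 : ℕ) : ℤ) * e1 - ((p 0 1 : ℕ) : ℤ) * e0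
    have hc0 : c 0 = 0 := (mul_eq_zero.mp h0).resolve_right h01
    have hc1 : c 1 = 0 := (mul_eq_zero.mp h1).resolve_right h01
    funext i; fin_cases i <;> simp [hk, hc0, hc1]

/-- ★ THE RELATION LATTICE OF AN NC ARC IS CYCLIC: `Λ_p = ℤ·c⁰`. -/
theorem relLattice_cyclic (p : Fin 3 → Expo)
    (hnc : ¬ (idet (p 0) (p 1) = 0 ∧ idet (p 0) (p 2) = 0 ∧ idet (p 1) (p 2) = 0)) :
    ∃ c₀ ∈ relLattice p, ∀ c ∈ relLattice p, ∃ n : ℤ, c = n • c₀ := by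
  obtain ⟨k, hk⟩ := exists_injective_coord p hnc
  set φ : (Fin 3 → ℤ) →+ ℤ := Pi.evalAddMonoidHom (fun _ : Fin 3 => ℤ) k with hφ
  obtain ⟨a, ha⟩ := Int.subgroup_cyclic ((relLattice p).map φ)
  have hmap : (relLattice p).map φ = AddSubgroup.zmultiples a := by
    rw [ha, AddSubgroup.zmultiples_eq_closure]
  have hamem : a ∈ (relLattice p).map φ := by rw [hmap]; exact AddSubgroup.mem_zmultiples a
  obtain ⟨c₀, hc₀, hc₀k⟩ := AddSubgroup.mem_map.mp hamem
  refine ⟨c₀, hc₀, fun c hc => ?_⟩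
  have hck : c k ∈ (relLattice p).map φ := AddSubgroup.mem_map.mpr ⟨c, hc, rfl⟩
  rw [hmap, Int.mem_zmultiples_iff] at hck
  obtain ⟨n, hn⟩ := hck
  refine ⟨n, ?_⟩
  have hdiff : c - n • c₀ ∈ relLattice p := by
    have := (relLattice p).sub_mem hc (zsmul_mem_relLattice hc₀ n)
    exact this
  have hz : (c - n • c₀) k = 0 := by
    have hφc₀ : φ c₀ = c₀ k := rfl
    simp only [Pi.sub_apply, Pi.smul_apply, smul_eq_mul]
    rw [← hφc₀, hc₀k, hn]; ring
  have := hk _ hdiff hz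
  exact sub_eq_zero.mp this

/-- a GENERATOR `c⁰` of the relation lattice of a pivot triple (`0` for a ray triple, where it is not used) -/
def genRel (p : Fin 3 → Expo) : Fin 3 → ℤ :=
  if h : ¬ (idet (p 0) (p 1) = 0 ∧ idet (p 0) (p 2) = 0 ∧ idet (p 1) (p 2) = 0) then (relLattice_cyclic p h).choose else 0

theorem genRel_spec (p : Fin 3 → Expo) (hnc : ¬ (idet (p 0) (p 1) = 0 ∧ idet (p 0) (p 2) = 0 ∧ idet (p 1) (p 2) = 0)) :
    genRel p ∈ relLattice p ∧ ∀ c ∈ relLattice p, ∃ n : ℤ, c = n • genRel p := by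
  have h := (relLattice_cyclic p hnc).choose_spec
  simp only [genRel, dif_pos hnc]
  exact ⟨h.1, h.2⟩

/-- integer vector of an exponent vector of `ℕ³` -/
def zvec (α : Fin 3 →₀ ℕ) : Fin 3 → ℤ := fun i => ((α i : ℕ) : ℤ)

theorem zvec_injective {α β : Fin 3 →₀ ℕ} (h : zvec α = zvec β) : α = β := by
  apply Finsupp.ext; intro i
  have := congrFun h i
  simp only [zvec] at this
  exact_mod_cast this

theorem zpiv_sub (p : Fin 3 → Expo) (c c' : Fin 3 → ℤ) : zpiv p (c - c') = zpiv p c - zpiv p c' := by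
  funext l
  simp only [zpiv, Pi.sub_apply, sub_mul, Finset.sum_sub_distrib]

theorem piv_apply (p : Fin 3 → Expo) (α : Fin 3 →₀ ℕ) (l : Fin 2) : piv p α l = ∑ k, α k * p k l := by
  unfold piv
  rw [Finsupp.finsetSum_apply]
  exact Finset.sum_congr rfl fun k _ => by rw [Finsupp.smul_apply, smul_eq_mul]

theorem zpiv_zvec (p : Fin 3 → Expo) (α : Fin 3 →₀ ℕ) (l : Fin 2) : zpiv p (zvec α) l = ((piv p α l : ℕ) : ℤ) := by
  rw [piv_apply]; push_cast; simp only [zpiv, zvec]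

theorem sub_mem_relLattice_of_piv_eq {p : Fin 3 → Expo} {α α' : Fin 3 →₀ ℕ} (h : piv p α' = piv p α) :
    zvec α' - zvec α ∈ relLattice p := by
  rw [mem_relLattice]
  funext l
  rw [zpiv_sub, Pi.sub_apply, zpiv_zvec, zpiv_zvec, h, sub_self, Pi.zero_apply]

/-- positive and negative parts of an integer vector -/
def zpos (c : Fin 3 → ℤ) : Fin 3 →₀ ℕ := Finsupp.equivFunOnFinite.symm (fun i => (c i).toNat)
def zneg (c : Fin 3 → ℤ) : Fin 3 →₀ ℕ := Finsupp.equivFunOnFinite.symm (fun i => (-c i).toNat)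

theorem zpos_apply (c : Fin 3 → ℤ) (i : Fin 3) : zpos c i = (c i).toNat := by
  simp [zpos]
theorem zneg_apply (c : Fin 3 → ℤ) (i : Fin 3) : zneg c i = (-c i).toNat := by
  simp [zneg]

theorem zpos_sub_zneg (c : Fin 3 → ℤ) (i : Fin 3) : ((zpos c i : ℕ) : ℤ) - ((zneg c i : ℕ) : ℤ) = c i := by
  rw [zpos_apply, zneg_apply]; exact Int.toNat_sub_toNat_neg (c i)

theorem zpos_zero_or_zneg_zero (c : Fin 3 → ℤ) (i : Fin 3) : zpos c i = 0 ∨ zneg c i = 0 := by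
  rw [zpos_apply, zneg_apply, Int.toNat_eq_zero, Int.toNat_eq_zero]; omega

theorem zvec_zpos_sub_zneg (c : Fin 3 → ℤ) : zvec (zpos c) - zvec (zneg c) = c := by
  funext i; simp only [zvec, Pi.sub_apply]; exact zpos_sub_zneg c i

theorem piv_zpos_eq (p : Fin 3 → Expo) {c : Fin 3 → ℤ} (hc : c ∈ relLattice p) : piv p (zpos c) = piv p (zneg c) := by
  apply Finsupp.ext; intro l
  have h : zpiv p c l = 0 := by rw [mem_relLattice.mp hc]; rfl
  have key : ((piv p (zpos c) l : ℕ) : ℤ) = ((piv p (zneg c) l : ℕ) : ℤ) := by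
    rw [← zpiv_zvec, ← zpiv_zvec, ← sub_eq_zero, ← Pi.sub_apply, ← zpiv_sub, zvec_zpos_sub_zneg, h]
  exact_mod_cast key

/-- ★★ TRANCHE B: PROGRESSION DATA EXIST ON AN NC ARC.  For pivots `p` not a ray triple and `deg P ≤ m`, with `c⁰ = genRel p`,
`c⁺ = zpos c⁰`, `c⁻ = zneg c⁰`: every fibre of `π_p` on `supp P` is an arithmetic progression `α = base(π α) + (idx α)·(c⁺ − c⁻)` with
`idx α ≤ m` — exactly the hypotheses `hidx / hprog` of the level-1 top theorem with `J = m` (`hrel` is `piv_zpos_eq`). [val-idea-35 g11] -/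
theorem exists_progData (P : Poly3) (m : ℕ) (hP : P.totalDegree ≤ m) (p : Fin 3 → Expo)
    (hnc : ¬ (idet (p 0) (p 1) = 0 ∧ idet (p 0) (p 2) = 0 ∧ idet (p 1) (p 2) = 0)) :
    ∃ (base : Expo → (Fin 3 →₀ ℕ)) (idx : (Fin 3 →₀ ℕ) → ℕ),
      (∀ α ∈ P.support, idx α ≤ m) ∧
      (∀ α ∈ P.support, α + m • zneg (genRel p) = base (piv p α) + idx α • zpos (genRel p) + (m - idx α) • zneg (genRel p)) := by
  obtain ⟨hc₀, hcyc⟩ := genRel_spec p hnc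
  set c₀ := genRel p with hc₀def
  -- degrees
  have hdeg : ∀ α ∈ P.support, ∀ i, α i ≤ m := by
    intro α hα i
    have h1 : (α.sum fun _ e => e) ≤ m := (MvPolynomial.le_totalDegree hα).trans hP
    have h2 : α i ≤ α.sum fun _ e => e := by
      rw [Finsupp.sum_fintype _ _ (fun _ => rfl)]
      exact Finset.single_le_sum (fun j _ => Nat.zero_le (α j)) (Finset.mem_univ i)
    exact h2.trans h1
  -- multipliers on fibre pairs
  have hpair : ∀ α α' : Fin 3 →₀ ℕ, ∃ n : ℤ, piv p α' = piv p α → zvec α' - zvec α = n • c₀ := by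
    intro α α'
    by_cases h : piv p α' = piv p α
    · obtain ⟨n, hn⟩ := hcyc _ (sub_mem_relLattice_of_piv_eq h)
      exact ⟨n, fun _ => hn⟩
    · exact ⟨0, fun h' => absurd h' h⟩
  choose nn hnn using hpair
  -- a reference element of each nonempty fibre
  have href' : ∀ q : Expo, ∃ r : Fin 3 →₀ ℕ, (∃ α ∈ P.support, piv p α = q) → (r ∈ P.support ∧ piv p r = q) := by
    intro q
    by_cases h : ∃ α ∈ P.support, piv p α = q
    · obtain ⟨α, hα, hq⟩ := h; exact ⟨α, fun _ => ⟨hα, hq⟩⟩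
    · exact ⟨0, fun h' => absurd h' h⟩
  choose ref href using href'
  -- base = a minimiser of the multiplier over the fibre
  have hb : ∀ q : Expo, ∃ b : Fin 3 →₀ ℕ, (∃ α ∈ P.support, piv p α = q) →
      (b ∈ P.support ∧ piv p b = q ∧ ∀ α' ∈ P.support, piv p α' = q → nn (ref q) b ≤ nn (ref q) α') := by
    intro q
    by_cases h : ∃ α ∈ P.support, piv p α = q
    · have hne : (P.support.filter fun α' => piv p α' = q).Nonempty := by
        obtain ⟨α, hα, hq⟩ := h; exact ⟨α, Finset.mem_filter.mpr ⟨hα, hq⟩⟩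
      obtain ⟨b, hbmem, hbmin⟩ := Finset.exists_min_image _ (fun α' => nn (ref q) α') hne
      exact ⟨b, fun _ => ⟨(Finset.mem_filter.mp hbmem).1, (Finset.mem_filter.mp hbmem).2,
        fun α' hα' hq' => hbmin α' (Finset.mem_filter.mpr ⟨hα', hq'⟩)⟩⟩
    · exact ⟨0, fun h' => absurd h' h⟩
  choose base hbase using hb
  -- the core computation on one fibre element
  have core : ∀ α ∈ P.support,
      0 ≤ nn (ref (piv p α)) α - nn (ref (piv p α)) (base (piv p α)) ∧
      nn (ref (piv p α)) α - nn (ref (piv p α)) (base (piv p α)) ≤ (m : ℤ) ∧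
      ∀ i, ((α i : ℕ) : ℤ) = ((base (piv p α) i : ℕ) : ℤ) + (nn (ref (piv p α)) α - nn (ref (piv p α)) (base (piv p α))) * c₀ i := by
    intro α hα
    set q := piv p α with hq
    have hex : ∃ α' ∈ P.support, piv p α' = q := ⟨α, hα, rfl⟩
    obtain ⟨hr, hrq⟩ := href q hex
    obtain ⟨hbs, hbq, hbmin⟩ := hbase q hex
    set r := ref q
    set b := base q
    set j := nn r α - nn r b with hj
    have e1 : zvec α - zvec r = nn r α • c₀ := hnn r α (by rw [hrq])
    have e2 : zvec b - zvec r = nn r b • c₀ := hnn r b (by rw [hbq, hrq])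
    have hj0 : 0 ≤ j := sub_nonneg.mpr (hbmin α hα rfl)
    have key : ∀ i, ((α i : ℕ) : ℤ) = ((b i : ℕ) : ℤ) + j * c₀ i := by
      intro i
      have h1 := congrFun e1 i
      have h2 := congrFun e2 i
      simp only [zvec, Pi.sub_apply, Pi.smul_apply, smul_eq_mul] at h1 h2
      rw [hj]; linear_combination h1 - h2
    refine ⟨hj0, ?_, key⟩
    by_cases hneg : ∃ i, c₀ i < 0
    · obtain ⟨i, hi⟩ := hneg
      have hαi : (0 : ℤ) ≤ ((α i : ℕ) : ℤ) := by exact_mod_cast Nat.zero_le _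
      have hbi : ((b i : ℕ) : ℤ) ≤ m := by exact_mod_cast hdeg b hbs i
      nlinarith [key i, mul_nonneg hj0 (by linarith : (0 : ℤ) ≤ -c₀ i - 1)]
    · push Not at hneg
      by_cases hpos : ∃ i, 0 < c₀ i
      · obtain ⟨i, hi⟩ := hpos
        have hαi : ((α i : ℕ) : ℤ) ≤ m := by exact_mod_cast hdeg α hα i
        have hbi : (0 : ℤ) ≤ ((b i : ℕ) : ℤ) := by exact_mod_cast Nat.zero_le _
        nlinarith [key i, mul_nonneg hj0 (by linarith : (0 : ℤ) ≤ c₀ i - 1)]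
      · push Not at hpos
        have hc0 : c₀ = 0 := funext fun i => le_antisymm (hpos i) (hneg i)
        have hαr : zvec α = zvec r := by
          have := e1; rw [hc0, smul_zero] at this; exact sub_eq_zero.mp this
        have hbr : zvec b = zvec r := by
          have := e2; rw [hc0, smul_zero] at this; exact sub_eq_zero.mp this
        have hbα : b = α := zvec_injective (hbr.trans hαr.symm)
        have : j = 0 := by rw [hj, hbα, sub_self]
        rw [this]; exact_mod_cast Nat.zero_le m
  refine ⟨base, fun α => (nn (ref (piv p α)) α - nn (ref (piv p α)) (base (piv p α))).toNat, ?_, ?_⟩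
  · intro α hα
    obtain ⟨_, hjm, _⟩ := core α hα
    exact Int.toNat_le.mpr hjm
  · intro α hα
    obtain ⟨hj0, hjm, key⟩ := core α hα
    set j := nn (ref (piv p α)) α - nn (ref (piv p α)) (base (piv p α)) with hj
    have ht : ((j.toNat : ℕ) : ℤ) = j := Int.toNat_of_nonneg hj0
    have htm : j.toNat ≤ m := Int.toNat_le.mpr hjm
    apply Finsupp.ext; intro i
    simp only [Finsupp.add_apply, Finsupp.smul_apply, smul_eq_mul]
    have goalZ : ((α i : ℕ) : ℤ) + (m : ℤ) * (zneg c₀ i : ℕ) =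
        (base (piv p α) i : ℕ) + (j.toNat : ℤ) * (zpos c₀ i : ℕ) + ((m : ℤ) - (j.toNat : ℤ)) * (zneg c₀ i : ℕ) := by
      rw [ht]; linear_combination key i - j * zpos_sub_zneg c₀ i
    have := goalZ
    rw [← Nat.cast_sub htm] at this
    exact_mod_cast this

/--
info: 'Summit.ValiantsHypothesis.ValiantsHypothesis.Cruxes.TwoProducts.ValIdea35g11Lattice.relLattice_cyclic' depends on axioms: [propext,
 Classical.choice,
 Quot.sound]
-/
#guard_msgs in
#print axioms relLattice_cyclic

/--
info: 'Summit.ValiantsHypothesis.ValiantsHypothesis.Cruxes.TwoProducts.ValIdea35g11Lattice.exists_progData' depends on axioms: [propext,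
 Classical.choice,
 Quot.sound]
-/
#guard_msgs in
#print axioms exists_progData

end LatticeG11


section TrancheC
/-  CONTENTS (all kernel-checked, no open bricks):
    (C0) vocabulary copies · (C1) `PerDirLevelOne` · (C2) `wt_dir_eq_unique`, `coinc`, `card_coinc_le` · (C3) `cand`, `mem_cand_of_isUniqueTop` ·
    (C4) C-COVER `Ef_subset_of_perDir` · (C5)/(S2) `card_Eset_twoSided_le`, `genRel_not_oneSigned`, `card_Eset_relBinomial_le`, `card_Eset_arcBinomial_le` ·
    (S1) `mono_add`, `mono_nsmul`, `aeval_monomial_eq`, `Eset_prod_subset`, `card_Eset_mono_le`, `card_Eset_linFactor_le`, `card_Eset_fibrePart_le`,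
    `card_Tset_fibrePart_le` · (S3) `totalDegree_bind₁_le_of_le_one'`, `nv_le_of_factorsThroughTwo`, `nv_le_of_constLetter` · (C6) `card_cand_le`,
    `card_Ef_le_of_perDir`, `card_Eset_le_of_perDir`, `nv_le_of_perDir_nonconst` · (S4) `binCap_le` … `levelOneCap_le_pow`, `constCap_le_pow` ·
    ★★ `levelOneLaw_of_perDir`. -/
open scoped Classical
open Summit.ValiantsHypothesis.ValiantsHypothesis.Theorems.TwoProducts.RankTwoJacobian
  (nv wt IsEdgeDir IsUniqueTop IsUTop dir Eset X3 S3 S1 OnArc idx3 Ef Tset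
   nv_le mem_Eset card_X3_le idx3_le exists_utop3 utop_const3 utop_onArc mem_Ef Ef_subset_Eset card_Tset_le isUniqueTop_iff
   support_subset_S3 mem_S1 support_nonempty' isEdgeDir_mul_left tie_S3_mem_X3 mem_S3 TieIn isEdgeDir_iff_tie Eset_zero
   Eset_mul_subset Eset_pow_subset Eset_neg Eset_C_mul Eset_C card_Eset_binomialAffine_le eq_C_of_S1_empty rankTwoCrudeBound nv_C_le)

/-! ### (C0) vocabulary — VERBATIM copies of the main workfile `RankThreeWronskian_val_idea_35_g10.lean` (REV 8 d6d5da6035d61edf) -/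

/-- no RAY TRIPLE among the letters' exponents (main workfile l.2985, verbatim) -/
def NoRayTriple (w : Fin 3 → Poly2) : Prop :=
  ∀ e₀ ∈ (w 0).support, ∀ e₁ ∈ (w 1).support, ∀ e₂ ∈ (w 2).support,
    ¬ (idet e₀ e₁ = 0 ∧ idet e₀ e₂ = 0 ∧ idet e₁ e₂ = 0)

/-- the fibre of `P` over `q` under `π_p` (main workfile l.2993, verbatim) -/
def fibre (P : Poly3) (p : Fin 3 → Expo) (q : Expo) : Poly3 :=
  ∑ α ∈ P.support.filter (fun α => piv p α = q), monomial α (coeff α P)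

/-- the fibre part `T_q = (fibre P p q)(w)` (main workfile l.2997, verbatim) -/
def fibrePart (w : Fin 3 → Poly2) (P : Poly3) (p : Fin 3 → Expo) (q : Expo) : Poly2 := aeval w (fibre P p q)

/-- fibre coincidence at `ν` (main workfile l.3037, verbatim) -/
def FibreCoincidence (w : Fin 3 → Poly2) (P : Poly3) (ν : Fin 2 → ℝ) (p : Fin 3 → Expo) (q q' e : Expo) : Prop :=
  q ≠ q' ∧ IsUniqueTop ν (fibrePart w P p q) e ∧ IsUniqueTop ν (fibrePart w P p q') e

/-- NFC (main workfile l.3043, verbatim) -/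
def NFC (w : Fin 3 → Poly2) (P : Poly3) : Prop :=
  ∀ (ν : Fin 2 → ℝ) (p : Fin 3 → Expo), (∀ i, IsUniqueTop ν (w i) (p i)) →
    ∀ q q' e : Expo, ¬ FibreCoincidence w P ν p q q' e

/-- the LEVEL-1 LAW, typed OPEN (main workfile l.3052, verbatim) -/
def LevelOneLaw : Prop :=
  ∃ c : ℕ, ∀ (m t : ℕ) (P : Poly3) (w : Fin 3 → Poly2),
    P.totalDegree ≤ m → (∀ i, (w i).support.card ≤ t) → NoRayTriple w → NFC w P →
    nv (MvPolynomial.aeval w P) ≤ (m + 2) ^ c * (t + 2) ^ c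

/-- the letter monomial `w^β` (main workfile l.3203, verbatim) -/
def mono (w : Fin 3 → Poly2) (β : Fin 3 →₀ ℕ) : Poly2 := ∏ i, w i ^ (β i)

/-- the ARC BINOMIAL `N_p := w^{c⁺} − (π-top coefficient ratio)·w^{c⁻}` of a pivot triple — ONE polynomial per triple `p`, of the T1-A
shape `w^{a} − κ·w^{b}` with `a, b ∈ ℕ³` of disjoint supports -/
def arcBinomial (w : Fin 3 → Poly2) (p : Fin 3 → Expo) : Poly2 :=
  mono w (zpos (genRel p)) -
    C (coeff (piv p (zpos (genRel p))) (mono w (zpos (genRel p))) / coeff (piv p (zpos (genRel p))) (mono w (zneg (genRel p)))) *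
      mono w (zneg (genRel p))

/-! ### (C1) the ONE hypothesis shape (D-0026): the per-direction level-1 theorem, ∀-closed -/

/-- **`PerDirLevelOne`** — HYPOTHESIS SHAPE (NOT asserted here): literally the ∀-closed statement of the A⧺B composition
`levelOne_not_isEdgeDir_nc` (HOME `g11/RankThreeWronskian-g11-rev9.lean` 9b6cb09563170788, crit-8 g5 #91), whose two halves are in tree:
TRANCHE A `levelOne_not_isEdgeDir` (main workfile REV 7/8) and TRANCHE B `exists_progData` (this file, REV 1). It is DISCHARGED by that kernel
(modus ponens) as soon as one file can import both (operator question b201); until then it is carried as a hypothesis. -/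
def PerDirLevelOne : Prop :=
  ∀ (ν : Fin 2 → ℝ) (w : Fin 3 → Poly2) (P : Poly3) (p : Fin 3 → Expo) (m : ℕ),
    P.totalDegree ≤ m → NoRayTriple w → (∀ i, IsUniqueTop ν (w i) (p i)) →
    ¬ IsEdgeDir ν (arcBinomial w p) →
    (∀ q q' e, ¬ FibreCoincidence w P ν p q q' e) →
    (∀ q q' e e', IsUniqueTop ν (fibrePart w P p q) e → IsUniqueTop ν (fibrePart w P p q') e' → e ≠ e' → wt ν e ≠ wt ν e') →
    ¬ IsEdgeDir ν (aeval w P)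

/-! ### (C2) the pair count (memo 16.3 (iii)) -/

/-- for `e ≠ e'` there is at most one chart parameter `μ` with equal `dir σ μ`-weights (`dir σ μ = ![μ, σ]`, `σ = ±1`). -/
theorem wt_dir_eq_unique {σ : ℝ} (hσ : σ = 1 ∨ σ = -1) {e e' : Expo} (hne : e ≠ e') {μ μ' : ℝ}
    (h : wt (dir σ μ) e = wt (dir σ μ) e') (h' : wt (dir σ μ') e = wt (dir σ μ') e') : μ = μ' := by
  unfold wt dir at h h'
  simp only [Matrix.cons_val_zero, Matrix.cons_val_one] at h h'
  have hσ0 : σ ≠ 0 := by rcases hσ with rfl | rfl <;> norm_num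
  by_cases h0 : (e 0 : ℝ) = (e' 0 : ℝ)
  · exfalso
    have h1 : σ * ((e 1 : ℕ) : ℝ) = σ * ((e' 1 : ℕ) : ℝ) := by rw [h0] at h; linarith
    have h1' : ((e 1 : ℕ) : ℝ) = ((e' 1 : ℕ) : ℝ) := mul_left_cancel₀ hσ0 h1
    apply hne
    ext i
    fin_cases i
    · exact_mod_cast h0
    · exact_mod_cast h1'
  · have hd : ((e 0 : ℕ) : ℝ) - ((e' 0 : ℕ) : ℝ) ≠ 0 := sub_ne_zero.mpr h0
    have k : μ * (((e 0 : ℕ) : ℝ) - ((e' 0 : ℕ) : ℝ)) = μ' * (((e 0 : ℕ) : ℝ) - ((e' 0 : ℕ) : ℝ)) := by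
      have a1 : μ * (((e 0 : ℕ) : ℝ) - ((e' 0 : ℕ) : ℝ)) = σ * ((e' 1 : ℕ) : ℝ) - σ * ((e 1 : ℕ) : ℝ) := by linear_combination h
      have a2 : μ' * (((e 0 : ℕ) : ℝ) - ((e' 0 : ℕ) : ℝ)) = σ * ((e' 1 : ℕ) : ℝ) - σ * ((e 1 : ℕ) : ℝ) := by linear_combination h'
      rw [a1, a2]
    exact mul_right_cancel₀ hd k

/-- the weight-coincidence parameters of a candidate set `E` inside a parameter set `M` -/
def coinc (σ : ℝ) (E : Finset Expo) (M : Finset ℝ) : Finset ℝ :=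
  M.filter (fun μ => ∃ e ∈ E, ∃ e' ∈ E, e ≠ e' ∧ wt (dir σ μ) e = wt (dir σ μ) e')

/-- `|coinc σ E M| ≤ |E|²`: each ordered pair `(e, e')`, `e ≠ e'`, accounts for at most one `μ` (`wt_dir_eq_unique`). -/
theorem card_coinc_le {σ : ℝ} (hσ : σ = 1 ∨ σ = -1) (E : Finset Expo) (M : Finset ℝ) :
    (coinc σ E M).card ≤ E.card * E.card := by
  classical
  -- choose for each μ ∈ coinc a witnessing pair; the choice is injective
  have hex : ∀ μ ∈ coinc σ E M, ∃ pr ∈ E ×ˢ E, pr.1 ≠ pr.2 ∧ wt (dir σ μ) pr.1 = wt (dir σ μ) pr.2 := by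
    intro μ hμ
    obtain ⟨_, e, he, e', he', hne, hw⟩ := Finset.mem_filter.mp hμ
    exact ⟨(e, e'), Finset.mk_mem_product he he', hne, hw⟩
  choose! f hf using hex
  rw [← Finset.card_product]
  refine Finset.card_le_card_of_injOn f (fun μ hμ => (hf μ hμ).1) ?_
  intro μ hμ μ' hμ' hff
  have h1 := (hf μ hμ).2
  have h2 := (hf μ' hμ').2
  rw [hff] at h1
  exact wt_dir_eq_unique hσ h2.1 h1.2 h2.2

/-! ### (C3) candidates: the chart-unique tops of the nonzero fibre parts -/

/-- the candidate top exponents on an arc with pivot triple `p`: chart-unique tops of the fibre parts over the image of `π_p` -/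
def cand (σ : ℝ) (w : Fin 3 → Poly2) (P : Poly3) (p : Fin 3 → Expo) : Finset Expo :=
  (P.support.image (piv p)).biUnion (fun q => Tset σ (fibrePart w P p q))

/-- a fibre part with a unique top is nonzero, so its fibre index is a value of `π_p` on `supp P` -/
theorem fibrePart_ne_zero_mem_image {ν : Fin 2 → ℝ} {w : Fin 3 → Poly2} {P : Poly3} {p : Fin 3 → Expo} {q e : Expo}
    (h : IsUniqueTop ν (fibrePart w P p q) e) : q ∈ P.support.image (piv p) := by
  by_contra hq
  have hz : fibre P p q = 0 := by
    unfold fibre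
    refine Finset.sum_eq_zero (fun α hα => ?_)
    exfalso
    exact hq (Finset.mem_image.mpr ⟨α, (Finset.mem_filter.mp hα).1, (Finset.mem_filter.mp hα).2⟩)
  have h1 := h.1
  unfold fibrePart at h1
  rw [hz, map_zero] at h1
  simp at h1

/-- a unique top of a fibre part at a chart direction is a candidate -/
theorem mem_cand_of_isUniqueTop {σ μ : ℝ} {w : Fin 3 → Poly2} {P : Poly3} {p : Fin 3 → Expo} {q e : Expo}
    (h : IsUniqueTop (dir σ μ) (fibrePart w P p q) e) : e ∈ cand σ w P p := by
  unfold cand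
  rw [Finset.mem_biUnion]
  refine ⟨q, fibrePart_ne_zero_mem_image h, ?_⟩
  unfold Tset
  exact Finset.mem_filter.mpr ⟨h.1, μ, (isUniqueTop_iff _ _ _).mp h⟩

/-! ### (C4) THE PER-ARC COVER (memo 16.2) -/

/-- **C-COVER on one chart-arc.** Under `PerDirLevelOne`, `NoRayTriple`, `NFC` and nonzero letters with unique tops `p` on arc `b`:
every edge parameter of `D = P(w)` on arc `b` is an edge parameter of the arc binomial `N_p` or a weight coincidence of two candidates.
Inputs ✓ by name: `mem_Ef`, `mem_Eset`, `utop_onArc`, `support_subset_S3`. -/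
theorem Ef_subset_of_perDir (H : PerDirLevelOne) {σ : ℝ} (hσ : σ = 1 ∨ σ = -1) {w : Fin 3 → Poly2} {P : Poly3} {m : ℕ}
    (hP : P.totalDegree ≤ m) (hNR : NoRayTriple w) (hNFC : NFC w P) (hw0 : ∀ i, w i ≠ 0) (b : ℕ) {μ₀ : ℝ}
    (hμ₀ : OnArc σ w b μ₀) (p : Fin 3 → Expo) (hp : ∀ i, IsUniqueTop (dir σ μ₀) (w i) (p i)) :
    Ef σ w b (aeval w P) ⊆ Eset σ (arcBinomial w p) ∪ coinc σ (cand σ w P p) (Ef σ w b (aeval w P)) := by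
  intro μ hμ
  obtain ⟨hedge, harc⟩ := (mem_Ef hσ).mp hμ
  have hpμ : ∀ i, IsUniqueTop (dir σ μ) (w i) (p i) :=
    fun i => utop_onArc hσ hμ₀ harc (hw0 i) (support_subset_S3 w i) (hp i)
  by_contra hnot
  rw [Finset.mem_union, not_or] at hnot
  obtain ⟨hN, hC⟩ := hnot
  have hN' : ¬ IsEdgeDir (dir σ μ) (arcBinomial w p) := fun h => hN ((mem_Eset hσ).mpr h)
  have hgen : ∀ q q' e e', IsUniqueTop (dir σ μ) (fibrePart w P p q) e → IsUniqueTop (dir σ μ) (fibrePart w P p q') e' →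
      e ≠ e' → wt (dir σ μ) e ≠ wt (dir σ μ) e' := by
    intro q q' e e' he he' hne hwt
    apply hC
    unfold coinc
    exact Finset.mem_filter.mpr ⟨hμ, e, mem_cand_of_isUniqueTop he, e', mem_cand_of_isUniqueTop he', hne, hwt⟩
  exact H (dir σ μ) w P p m hP hNR hpμ hN' (hNFC (dir σ μ) p hpμ) hgen hedge

/-! ### (C5) caps and the relation-binomial count (S2) -/

/-- `β(t)` of T1-A ✓ `card_Eset_binomialAffine_le` plus the letters' `9t²` (✓ `card_X3_le`) for the degenerate (monomial) shapes -/
def binCap (t : ℕ) : ℕ := 4 * t ^ 6 + 5 * t ^ 2 + 3 * t + 2 + 9 * t ^ 2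

/-- T1-A at a ROTATION of the letters: if `c⁻` lives on the single letter `k` and `c⁺` avoids `k`, then `w^{c⁺} − κ w^{c⁻}` is
`W₀^a W₁^b − κ W₂^d` for `W` = `w` rotated so that `k` comes last; ✓ `card_Eset_binomialAffine_le` BY NAME. -/
theorem card_Eset_twoSided_le {σ : ℝ} (hσ : σ = 1 ∨ σ = -1) {t : ℕ} (w : Fin 3 → Poly2)
    (hw : ∀ i, (w i).support.card ≤ t) (κ : ℂ) (cp cm : Fin 3 →₀ ℕ) (k : Fin 3)
    (hcm : ∀ i, i ≠ k → cm i = 0) (hcp : cp k = 0) :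
    (Eset σ (mono w cp - C κ * mono w cm)).card ≤ 4 * t ^ 6 + 5 * t ^ 2 + 3 * t + 2 := by
  have e3 : ∀ c : Fin 3 →₀ ℕ, mono w c = w 0 ^ c 0 * w 1 ^ c 1 * w 2 ^ c 2 := fun c => by
    unfold mono; rw [Fin.prod_univ_three]
  fin_cases k
  · have h1 : cm 1 = 0 := hcm 1 (by decide)
    have h2 : cm 2 = 0 := hcm 2 (by decide)
    have hform : mono w cp - C κ * mono w cm =
        (![w 1, w 2, w 0] 0) ^ cp 1 * (![w 1, w 2, w 0] 1) ^ cp 2 - C κ * (![w 1, w 2, w 0] 2) ^ cm 0 := by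
      rw [e3, e3, h1, h2]
      simp only [Fin.isValue, Fin.zero_eta] at hcp
      simp [hcp]
    rw [hform]
    exact card_Eset_binomialAffine_le hσ ![w 1, w 2, w 0] (by intro i; fin_cases i <;> simpa using hw _) _ _ _ κ
  · have h0 : cm 0 = 0 := hcm 0 (by decide)
    have h2 : cm 2 = 0 := hcm 2 (by decide)
    have hform : mono w cp - C κ * mono w cm =
        (![w 0, w 2, w 1] 0) ^ cp 0 * (![w 0, w 2, w 1] 1) ^ cp 2 - C κ * (![w 0, w 2, w 1] 2) ^ cm 1 := by
      rw [e3, e3, h0, h2]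
      simp only [Fin.isValue, Fin.mk_one] at hcp
      simp [hcp]
    rw [hform]
    exact card_Eset_binomialAffine_le hσ ![w 0, w 2, w 1] (by intro i; fin_cases i <;> simpa using hw _) _ _ _ κ
  · have h0 : cm 0 = 0 := hcm 0 (by decide)
    have h1 : cm 1 = 0 := hcm 1 (by decide)
    have hform : mono w cp - C κ * mono w cm = w 0 ^ cp 0 * w 1 ^ cp 1 - C κ * w 2 ^ cm 2 := by
      rw [e3, e3, h0, h1]
      simp only [Fin.isValue, Fin.reduceFinMk] at hcp
      simp [hcp]
    rw [hform]
    exact card_Eset_binomialAffine_le hσ w hw _ _ _ κ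

/-- SIGN OF THE PRIMITIVE RELATION: under no-ray-triple tops, `genRel p` is neither all-positive nor all-negative (a relation
`Σ gᵢ pᵢ = 0` with all `gᵢ` of one strict sign and `pᵢ ∈ ℕ²` forces `p = 0`, a ray triple). -/
theorem genRel_not_oneSigned (p : Fin 3 → Expo)
    (hnc : ¬ (idet (p 0) (p 1) = 0 ∧ idet (p 0) (p 2) = 0 ∧ idet (p 1) (p 2) = 0)) (s : ℤ)
    (hall : ∀ j, 0 < s * genRel p j) : False := by
  have hrel : zpiv p (genRel p) = 0 := mem_relLattice.mp (genRel_spec p hnc).1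
  have hp0 : ∀ k l, ((p k l : ℕ) : ℤ) = 0 := by
    intro k l
    have hz0 : ∑ j, genRel p j * ((p j l : ℕ) : ℤ) = 0 := by
      have := congrFun hrel l
      simpa [zpiv] using this
    have hz : ∑ j, (s * genRel p j) * ((p j l : ℕ) : ℤ) = 0 := by
      have : ∑ j, (s * genRel p j) * ((p j l : ℕ) : ℤ) = s * ∑ j, genRel p j * ((p j l : ℕ) : ℤ) := by
        rw [Finset.mul_sum]
        exact Finset.sum_congr rfl (fun j _ => by ring)
      rw [this, hz0, mul_zero]
    have hnn : ∀ j ∈ (Finset.univ : Finset (Fin 3)), 0 ≤ (s * genRel p j) * ((p j l : ℕ) : ℤ) :=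
      fun j _ => mul_nonneg (hall j).le (by positivity)
    have := (Finset.sum_eq_zero_iff_of_nonneg hnn).mp hz k (Finset.mem_univ _)
    rcases mul_eq_zero.mp this with h | h
    · exact absurd h (hall k).ne'
    · exact h
  apply hnc
  have hid : ∀ i j, idet (p i) (p j) = 0 := fun i j => by unfold idet; rw [hp0, hp0, hp0, hp0]; ring
  exact ⟨hid 0 1, hid 0 2, hid 1 2⟩

/-- (S2) SHAPE MATCH for the RELATION BINOMIALS `w^{c⁺} − κ·w^{c⁻}` (`c^± = zpos/zneg (genRel p)`, disjoint supports by
`zpos_zero_or_zneg_zero`; by `genRel_not_oneSigned` the sign pattern of the primitive relation leaves ≤ 2 letters on one side and ≤ 1 on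
the other), so each is `W₀^a W₁^b − κ′ W₂^d` for a rotation `W` of the letters, possibly after the swap `A − κB = (−κ)·(B − κ⁻¹A)`
(✓ `Eset_C_mul`), and ✓ `card_Eset_binomialAffine_le` gives `|Eset σ (w^{c⁺} − κ w^{c⁻})| ≤ β(t) ≤ binCap t` for EVERY `κ`
(the F-SPLIT factors of (S1) have this shape too). -/
theorem card_Eset_relBinomial_le {σ : ℝ} (hσ : σ = 1 ∨ σ = -1) {t : ℕ} (w : Fin 3 → Poly2)
    (hw : ∀ i, (w i).support.card ≤ t) (p : Fin 3 → Expo)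
    (hnc : ¬ (idet (p 0) (p 1) = 0 ∧ idet (p 0) (p 2) = 0 ∧ idet (p 1) (p 2) = 0)) (κ : ℂ) :
    (Eset σ (mono w (zpos (genRel p)) - C κ * mono w (zneg (genRel p)))).card ≤ binCap t := by
  have hβ : 4 * t ^ 6 + 5 * t ^ 2 + 3 * t + 2 ≤ binCap t := by unfold binCap; omega
  refine le_trans ?_ hβ
  set g := genRel p with hg
  have hpos : ¬ (0 < g 0 ∧ 0 < g 1 ∧ 0 < g 2) := fun h =>
    genRel_not_oneSigned p hnc 1 (fun j => by fin_cases j <;> simp [← hg, h.1, h.2.1, h.2.2])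
  have hneg : ¬ (g 0 < 0 ∧ g 1 < 0 ∧ g 2 < 0) := fun h =>
    genRel_not_oneSigned p hnc (-1) (fun j => by fin_cases j <;> simp [← hg, h.1, h.2.1, h.2.2])
  -- `zpos g i = 0 ↔ g i ≤ 0`, `zneg g i = 0 ↔ 0 ≤ g i`
  have zp : ∀ i, g i ≤ 0 → zpos g i = 0 := fun i h => by rw [zpos_apply, Int.toNat_eq_zero]; exact h
  have zn : ∀ i, 0 ≤ g i → zneg g i = 0 := fun i h => by rw [zneg_apply, Int.toNat_eq_zero]; omega
  have hsign : (g 0 ≤ 0 ∧ 0 ≤ g 1 ∧ 0 ≤ g 2) ∨ (g 1 ≤ 0 ∧ 0 ≤ g 0 ∧ 0 ≤ g 2) ∨ (g 2 ≤ 0 ∧ 0 ≤ g 0 ∧ 0 ≤ g 1) ∨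
      (0 ≤ g 0 ∧ g 1 ≤ 0 ∧ g 2 ≤ 0) ∨ (0 ≤ g 1 ∧ g 0 ≤ 0 ∧ g 2 ≤ 0) ∨ (0 ≤ g 2 ∧ g 0 ≤ 0 ∧ g 1 ≤ 0) := by omega
  -- CASE A(k): `c⁻ ⊆ {k}`, `c⁺ k = 0` — direct; CASE B(k): `c⁺ ⊆ {k}`, `c⁻ k = 0` — after the swap (or `κ = 0`: a letter monomial)
  have caseA : ∀ k : Fin 3, g k ≤ 0 → (∀ i, i ≠ k → 0 ≤ g i) →
      (Eset σ (mono w (zpos g) - C κ * mono w (zneg g))).card ≤ 4 * t ^ 6 + 5 * t ^ 2 + 3 * t + 2 :=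
    fun k hk hi => card_Eset_twoSided_le hσ w hw κ (zpos g) (zneg g) k (fun i h => zn i (hi i h)) (zp k hk)
  have caseB : ∀ k : Fin 3, 0 ≤ g k → (∀ i, i ≠ k → g i ≤ 0) →
      (Eset σ (mono w (zpos g) - C κ * mono w (zneg g))).card ≤ 4 * t ^ 6 + 5 * t ^ 2 + 3 * t + 2 := by
    intro k hk hi
    by_cases hκ : κ = 0
    · -- a letter monomial `w_k^a` (or `1`): `mono w c⁺ − 0 = mono w c⁺ − C 0 * mono w 0`
      obtain ⟨k', hk'⟩ : ∃ k' : Fin 3, k' ≠ k := by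
        refine ⟨k + 1, fun h => ?_⟩
        have := congrArg Fin.val h; fin_cases k <;> simp at this
      have hre : mono w (zpos g) - C κ * mono w (zneg g) = mono w (zpos g) - C 0 * mono w 0 := by
        rw [hκ, C_0, zero_mul, zero_mul]
      rw [hre]
      exact card_Eset_twoSided_le hσ w hw 0 (zpos g) 0 k' (fun i _ => rfl) (zp k' (hi k' hk'))
    · have hid : mono w (zpos g) - C κ * mono w (zneg g) = C (-κ) * (mono w (zneg g) - C κ⁻¹ * mono w (zpos g)) := by
        have hk1 : C (-κ) * C κ⁻¹ = (-1 : Poly2) := by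
          rw [← C_mul, neg_mul, mul_inv_cancel₀ hκ, C_neg, C_1]
        calc mono w (zpos g) - C κ * mono w (zneg g)
            = -(C (-κ) * C κ⁻¹) * mono w (zpos g) + C (-κ) * mono w (zneg g) := by rw [hk1, C_neg]; ring
          _ = C (-κ) * (mono w (zneg g) - C κ⁻¹ * mono w (zpos g)) := by ring
      rw [hid, Eset_C_mul σ (neg_ne_zero.mpr hκ)]
      exact card_Eset_twoSided_le hσ w hw κ⁻¹ (zneg g) (zpos g) k (fun i h => zp i (hi i h)) (zn k hk)
  rcases hsign with h | h | h | h | h | h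
  · exact caseA 0 h.1 (fun i hi => by fin_cases i <;> first | exact absurd rfl hi | exact h.2.1 | exact h.2.2)
  · exact caseA 1 h.1 (fun i hi => by fin_cases i <;> first | exact absurd rfl hi | exact h.2.1 | exact h.2.2)
  · exact caseA 2 h.1 (fun i hi => by fin_cases i <;> first | exact absurd rfl hi | exact h.2.1 | exact h.2.2)
  · exact caseB 0 h.1 (fun i hi => by fin_cases i <;> first | exact absurd rfl hi | exact h.2.1 | exact h.2.2)
  · exact caseB 1 h.1 (fun i hi => by fin_cases i <;> first | exact absurd rfl hi | exact h.2.1 | exact h.2.2)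
  · exact caseB 2 h.1 (fun i hi => by fin_cases i <;> first | exact absurd rfl hi | exact h.2.1 | exact h.2.2)

/-- (S2 at the arc binomial) `|Eset σ N_p| ≤ binCap t`. -/
theorem card_Eset_arcBinomial_le {σ : ℝ} (hσ : σ = 1 ∨ σ = -1) {t : ℕ} (w : Fin 3 → Poly2)
    (hw : ∀ i, (w i).support.card ≤ t) (p : Fin 3 → Expo)
    (hnc : ¬ (idet (p 0) (p 1) = 0 ∧ idet (p 0) (p 2) = 0 ∧ idet (p 1) (p 2) = 0)) :
    (Eset σ (arcBinomial w p)).card ≤ binCap t :=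
  card_Eset_relBinomial_le hσ w hw p hnc _

/-! ### (S1) the fibre-part count via F-SPLIT -/

/-- `mono` is additive (main workfile l.3205, verbatim) -/
theorem mono_add (w : Fin 3 → Poly2) (β β' : Fin 3 →₀ ℕ) : mono w (β + β') = mono w β * mono w β' := by
  unfold mono
  rw [← Finset.prod_mul_distrib]
  exact Finset.prod_congr rfl fun i _ => by rw [Finsupp.add_apply, pow_add]

/-- `mono` turns multiples into powers (main workfile l.3210, verbatim) -/
theorem mono_nsmul (w : Fin 3 → Poly2) (n : ℕ) (β : Fin 3 →₀ ℕ) : mono w (n • β) = mono w β ^ n := by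
  unfold mono
  rw [← Finset.prod_pow]
  exact Finset.prod_congr rfl fun i _ => by rw [Finsupp.smul_apply, smul_eq_mul, pow_mul']

/-- evaluation of a monomial at the letters (main workfile l.3215, verbatim) -/
theorem aeval_monomial_eq (w : Fin 3 → Poly2) (β : Fin 3 →₀ ℕ) (a : ℂ) :
    aeval w (monomial β a) = C a * mono w β := by
  rw [MvPolynomial.aeval_monomial, MvPolynomial.algebraMap_eq, Finsupp.prod_fintype _ _ (fun i => by simp)]
  rfl

/-- a letter monomial of nonzero letters is nonzero (`ℂ[x,y]` is a domain) -/
theorem mono_ne_zero {w : Fin 3 → Poly2} (hw0 : ∀ i, w i ≠ 0) (c : Fin 3 →₀ ℕ) : mono w c ≠ 0 := by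
  unfold mono
  exact Finset.prod_ne_zero_iff.mpr (fun i _ => pow_ne_zero _ (hw0 i))

/-- edges of a product of nonzero polynomials come from the factors (✓ `Eset_mul_subset`, iterated; ✓ `Eset_C` for the empty product) -/
theorem Eset_prod_subset {σ : ℝ} (hσ : σ = 1 ∨ σ = -1) {ι : Type*} [DecidableEq ι] (s : Finset ι) (f : ι → Poly2) :
    (∀ i ∈ s, f i ≠ 0) → Eset σ (∏ i ∈ s, f i) ⊆ s.biUnion (fun i => Eset σ (f i)) := by
  refine Finset.induction_on s ?_ ?_
  · intro _
    rw [Finset.prod_empty, ← C_1, Eset_C]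
    exact Finset.empty_subset _
  · intro a s ha ih h
    rw [Finset.prod_insert ha, Finset.biUnion_insert]
    have hfa : f a ≠ 0 := h a (Finset.mem_insert_self a s)
    have hs : ∀ i ∈ s, f i ≠ 0 := fun i hi => h i (Finset.mem_insert_of_mem hi)
    have hprod : ∏ i ∈ s, f i ≠ 0 := Finset.prod_ne_zero_iff.mpr hs
    exact (Eset_mul_subset hσ hfa hprod).trans (Finset.union_subset_union (le_refl _) (ih hs))

/-- a letter's edge parameters are letter ties: `Eset σ (w i) ⊆ X3 σ w` (✓ `tie_S3_mem_X3`, ✓ `support_subset_S3`, ✓ `isEdgeDir_iff_tie`) -/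
theorem Eset_letter_subset_X3 {σ : ℝ} (hσ : σ = 1 ∨ σ = -1) (w : Fin 3 → Poly2) (i : Fin 3) : Eset σ (w i) ⊆ X3 σ w :=
  fun _ hμ => tie_S3_mem_X3 hσ (support_subset_S3 w i) ((isEdgeDir_iff_tie _ _).mp ((mem_Eset hσ).mp hμ))

/-- `|Eset σ (w^c)| ≤ 9t²`: edges of a letter monomial are letter edges (✓ `Eset_pow_subset`, `Eset_prod_subset`, ✓ `card_X3_le`) -/
theorem card_Eset_mono_le {σ : ℝ} (hσ : σ = 1 ∨ σ = -1) {t : ℕ} (w : Fin 3 → Poly2) (hw : ∀ i, (w i).support.card ≤ t)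
    (hw0 : ∀ i, w i ≠ 0) (c : Fin 3 →₀ ℕ) : (Eset σ (mono w c)).card ≤ 9 * t ^ 2 := by
  classical
  have hsub : Eset σ (mono w c) ⊆ X3 σ w := by
    unfold mono
    refine (Eset_prod_subset hσ Finset.univ (fun i => w i ^ c i) (fun i _ => pow_ne_zero _ (hw0 i))).trans ?_
    intro μ hμ
    obtain ⟨i, -, hi⟩ := Finset.mem_biUnion.mp hμ
    exact Eset_letter_subset_X3 hσ w i (Eset_pow_subset hσ (w i) (c i) hi)
  exact (Finset.card_le_card hsub).trans (card_X3_le σ hw)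

/-- a LINEAR FACTOR of the F-SPLIT, `u·w^{c⁺} + v·w^{c⁻}` (nonzero), is a relation binomial up to a scalar (`u ≠ 0`, ✓ `Eset_C_mul`,
(S2)) or a letter monomial (`u = 0`): `|Eset| ≤ binCap t`. -/
theorem card_Eset_linFactor_le {σ : ℝ} (hσ : σ = 1 ∨ σ = -1) {t : ℕ} (w : Fin 3 → Poly2) (hw : ∀ i, (w i).support.card ≤ t)
    (hw0 : ∀ i, w i ≠ 0) (p : Fin 3 → Expo) (hnc : ¬ (idet (p 0) (p 1) = 0 ∧ idet (p 0) (p 2) = 0 ∧ idet (p 1) (p 2) = 0))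
    (u v : ℂ) (hL : C u * mono w (zpos (genRel p)) + C v * mono w (zneg (genRel p)) ≠ 0) :
    (Eset σ (C u * mono w (zpos (genRel p)) + C v * mono w (zneg (genRel p)))).card ≤ binCap t := by
  by_cases hu : u = 0
  · have hv : v ≠ 0 := by
      rintro rfl
      apply hL
      rw [hu, C_0, zero_mul, zero_mul, add_zero]
    rw [hu, C_0, zero_mul, zero_add, Eset_C_mul σ hv]
    exact (card_Eset_mono_le hσ w hw hw0 _).trans (by unfold binCap; omega)
  · have hid : C u * mono w (zpos (genRel p)) + C v * mono w (zneg (genRel p)) =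
        C u * (mono w (zpos (genRel p)) - C (-v / u) * mono w (zneg (genRel p))) := by
      have hc : C u * C (-v / u) = (-C v : Poly2) := by
        rw [← C_mul, ← C_neg]
        congr 1
        field_simp
      rw [mul_sub, ← mul_assoc, hc]
      ring
    rw [hid, Eset_C_mul σ hu]
    exact card_Eset_relBinomial_le hσ w hw p hnc _

/-- (S1, `Eset` form) FIBRE-PART COUNT via F-SPLIT: on the progression fibre (★★ `exists_progData`, REV 1) `T_q · (w^{c⁻})^m =
w^{base q} · Φ_q(w^{c⁺}, w^{c⁻})` with `Φ_q` a binary form of degree `m`; ✓ `Literature.RingTheory.MvPolynomial.exists_C_mul_prod_linear_of_isHomogeneous`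
splits `Φ_q` into `m` linear forms; ✓ `isEdgeDir_mul_left` (half of ✓ `ostrowski`; letters nonzero) moves the edges of `T_q` into that product,
`Eset_prod_subset` (✓ `Eset_mul_subset`) splits it, `card_Eset_mono_le` and `card_Eset_linFactor_le` ((S2)) count: `|Eset σ T_q| ≤ 9t² + m·binCap t`. -/
theorem card_Eset_fibrePart_le {σ : ℝ} (hσ : σ = 1 ∨ σ = -1) {t m : ℕ} (w : Fin 3 → Poly2)
    (hw : ∀ i, (w i).support.card ≤ t) (hw0 : ∀ i, w i ≠ 0) (P : Poly3) (hP : P.totalDegree ≤ m) (p : Fin 3 → Expo)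
    (hnc : ¬ (idet (p 0) (p 1) = 0 ∧ idet (p 0) (p 2) = 0 ∧ idet (p 1) (p 2) = 0)) (q : Expo) :
    (Eset σ (fibrePart w P p q)).card ≤ 9 * t ^ 2 + m * binCap t := by
  classical
  by_cases hT0 : fibrePart w P p q = 0
  · rw [hT0, Eset_zero]; simp
  obtain ⟨base, idx, hidx, hprog⟩ := exists_progData P m hP p hnc
  -- the binary form of the fibre
  obtain ⟨Φ, hΦ⟩ : ∃ Φ : MvPolynomial (Fin 2) ℂ, Φ = ∑ α ∈ P.support.filter (fun α => piv p α = q),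
      C (coeff α P) * X 0 ^ (idx α) * X 1 ^ (m - idx α) := ⟨_, rfl⟩
  -- (i) the identity `T · B^m = w^{base q} · Φ(A, B)`
  have h1 : fibrePart w P p q = ∑ α ∈ P.support.filter (fun α => piv p α = q), C (coeff α P) * mono w α := by
    unfold fibrePart fibre
    rw [map_sum]
    exact Finset.sum_congr rfl (fun α _ => aeval_monomial_eq w α _)
  have h2 : aeval ![mono w (zpos (genRel p)), mono w (zneg (genRel p))] Φ =
      ∑ α ∈ P.support.filter (fun α => piv p α = q), C (coeff α P) * mono w (zpos (genRel p)) ^ (idx α) * mono w (zneg (genRel p)) ^ (m - idx α) := by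
    rw [hΦ, map_sum]
    refine Finset.sum_congr rfl (fun α _ => ?_)
    simp only [map_mul, map_pow, aeval_C, aeval_X, MvPolynomial.algebraMap_eq, Matrix.cons_val_zero, Matrix.cons_val_one]
  have hTB : fibrePart w P p q * mono w (zneg (genRel p)) ^ m = mono w (base q) * aeval ![mono w (zpos (genRel p)), mono w (zneg (genRel p))] Φ := by
    rw [h1, h2, Finset.sum_mul, Finset.mul_sum]
    refine Finset.sum_congr rfl (fun α hα => ?_)
    obtain ⟨hαP, hαq⟩ := Finset.mem_filter.mp hα
    have key := hprog α hαP
    rw [hαq] at key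
    have hm : mono w α * mono w (zneg (genRel p)) ^ m = mono w (base q) * mono w (zpos (genRel p)) ^ (idx α) * mono w (zneg (genRel p)) ^ (m - idx α) := by
      rw [← mono_nsmul, ← mono_add, key, mono_add, mono_add, mono_nsmul, mono_nsmul]
    calc C (coeff α P) * mono w α * mono w (zneg (genRel p)) ^ m = C (coeff α P) * (mono w α * mono w (zneg (genRel p)) ^ m) := by ring
      _ = mono w (base q) * (C (coeff α P) * mono w (zpos (genRel p)) ^ (idx α) * mono w (zneg (genRel p)) ^ (m - idx α)) := by rw [hm]; ring
  -- (ii) `Φ` is a binary form of degree `m`; F-SPLIT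
  have hhom : Φ.IsHomogeneous m := by
    rw [hΦ]
    apply IsHomogeneous.sum
    intro α hα
    have hi : idx α ≤ m := hidx α (Finset.mem_filter.mp hα).1
    have h := ((isHomogeneous_C (σ := Fin 2) (r := coeff α P)).mul
      ((isHomogeneous_X (R := ℂ) (i := (0 : Fin 2))).pow (idx α))).mul
      ((isHomogeneous_X (R := ℂ) (i := (1 : Fin 2))).pow (m - idx α))
    have e : 0 + 1 * idx α + 1 * (m - idx α) = m := by omega
    rwa [e] at h
  obtain ⟨c, u, v, hfac⟩ := Literature.RingTheory.MvPolynomial.exists_C_mul_prod_linear_of_isHomogeneous hhom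
  -- (iii) nonvanishing
  have hB0 : mono w (zneg (genRel p)) ≠ 0 := mono_ne_zero hw0 _
  have hBm : mono w (zneg (genRel p)) ^ m ≠ 0 := pow_ne_zero _ hB0
  have hM0 : mono w (base q) ≠ 0 := mono_ne_zero hw0 _
  have hprodeq : fibrePart w P p q * mono w (zneg (genRel p)) ^ m =
      mono w (base q) * (C c * ∏ i, (C (u i) * mono w (zpos (genRel p)) + C (v i) * mono w (zneg (genRel p)))) := by
    rw [hTB, hfac, map_mul, map_prod, aeval_C, MvPolynomial.algebraMap_eq]
    congr 2
    exact Finset.prod_congr rfl (fun i _ => by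
      simp only [map_add, map_mul, aeval_C, aeval_X, MvPolynomial.algebraMap_eq, Matrix.cons_val_zero, Matrix.cons_val_one])
  have hTB0 : mono w (base q) * (C c * ∏ i, (C (u i) * mono w (zpos (genRel p)) + C (v i) * mono w (zneg (genRel p)))) ≠ 0 := by
    rw [← hprodeq]; exact mul_ne_zero hT0 hBm
  have hR0 : C c * ∏ i, (C (u i) * mono w (zpos (genRel p)) + C (v i) * mono w (zneg (genRel p))) ≠ 0 := (mul_ne_zero_iff.mp hTB0).2
  have hc0 : c ≠ 0 := by
    rintro rfl; apply hR0; rw [C_0, zero_mul]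
  have hprod0 : ∏ i, (C (u i) * mono w (zpos (genRel p)) + C (v i) * mono w (zneg (genRel p))) ≠ 0 := (mul_ne_zero_iff.mp hR0).2
  have hfi : ∀ i ∈ (Finset.univ : Finset (Fin m)), C (u i) * mono w (zpos (genRel p)) + C (v i) * mono w (zneg (genRel p)) ≠ 0 :=
    Finset.prod_ne_zero_iff.mp hprod0
  -- (iv) containment of the edge parameters
  have hsub : Eset σ (fibrePart w P p q) ⊆ Eset σ (mono w (base q)) ∪
      (Finset.univ : Finset (Fin m)).biUnion (fun i => Eset σ (C (u i) * mono w (zpos (genRel p)) + C (v i) * mono w (zneg (genRel p)))) := by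
    intro μ hμ
    have he : IsEdgeDir (dir σ μ) (fibrePart w P p q) := (mem_Eset hσ).mp hμ
    have he2 : IsEdgeDir (dir σ μ) (fibrePart w P p q * mono w (zneg (genRel p)) ^ m) := isEdgeDir_mul_left _ _ _ hBm he
    have hμ2 : μ ∈ Eset σ (fibrePart w P p q * mono w (zneg (genRel p)) ^ m) := (mem_Eset hσ).mpr he2
    rw [hprodeq] at hμ2
    have h3 := Eset_mul_subset hσ hM0 hR0 hμ2
    rw [Eset_C_mul σ hc0] at h3
    rcases Finset.mem_union.mp h3 with h | h
    · exact Finset.mem_union_left _ h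
    · exact Finset.mem_union_right _ (Eset_prod_subset hσ Finset.univ _ hfi h)
  -- (v) count
  calc (Eset σ (fibrePart w P p q)).card
      ≤ (Eset σ (mono w (base q)) ∪
          (Finset.univ : Finset (Fin m)).biUnion (fun i => Eset σ (C (u i) * mono w (zpos (genRel p)) + C (v i) * mono w (zneg (genRel p))))).card :=
        Finset.card_le_card hsub
    _ ≤ (Eset σ (mono w (base q))).card +
          ((Finset.univ : Finset (Fin m)).biUnion (fun i => Eset σ (C (u i) * mono w (zpos (genRel p)) + C (v i) * mono w (zneg (genRel p))))).card :=
        Finset.card_union_le _ _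
    _ ≤ 9 * t ^ 2 + ∑ i : Fin m, (Eset σ (C (u i) * mono w (zpos (genRel p)) + C (v i) * mono w (zneg (genRel p)))).card :=
        Nat.add_le_add (card_Eset_mono_le hσ w hw hw0 _) Finset.card_biUnion_le
    _ ≤ 9 * t ^ 2 + ∑ _i : Fin m, binCap t :=
        Nat.add_le_add_left (Finset.sum_le_sum (fun i hi => card_Eset_linFactor_le hσ w hw hw0 p hnc (u i) (v i) (hfi i hi))) _
    _ = 9 * t ^ 2 + m * binCap t := by rw [Finset.sum_const, Finset.card_univ, Fintype.card_fin, smul_eq_mul]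

/-- (S1) `|Tset σ T_q| ≤ 9t² + m·binCap t + 1` (✓ `card_Tset_le` on top of `card_Eset_fibrePart_le`). -/
theorem card_Tset_fibrePart_le {σ : ℝ} (hσ : σ = 1 ∨ σ = -1) {t m : ℕ} (w : Fin 3 → Poly2)
    (hw : ∀ i, (w i).support.card ≤ t) (hw0 : ∀ i, w i ≠ 0) (P : Poly3) (hP : P.totalDegree ≤ m) (p : Fin 3 → Expo)
    (hnc : ¬ (idet (p 0) (p 1) = 0 ∧ idet (p 0) (p 2) = 0 ∧ idet (p 1) (p 2) = 0)) (q : Expo) :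
    (Tset σ (fibrePart w P p q)).card ≤ 9 * t ^ 2 + m * binCap t + 1 :=
  (card_Tset_le hσ _).trans (Nat.add_le_add_right (card_Eset_fibrePart_le hσ w hw hw0 P hP p hnc q) 1)

/-- the constant-letter cap (✓ `rankTwoCrudeBound`'s right-hand side) -/
def constCap (m t : ℕ) : ℕ := 2 * ((m + 1) * (3 * (t * t + t) + 2 + (t * t) * (t * t))) + 4

/-- substitution by polynomials of total degree ≤ 1 does not raise the total degree (same statement and proof as ✓
`Literature.Computability.AlgebraicComplexity.AndrewsForbes2022Thm38Proofs.totalDegree_bind₁_le_of_le_one`; restated here only to keep the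
import list of crit-8 #104 (T-d)). -/
private theorem totalDegree_bind₁_le_of_le_one' {σ τ : Type*} (θ : σ → MvPolynomial τ ℂ) (hθ : ∀ i, (θ i).totalDegree ≤ 1)
    (Q : MvPolynomial σ ℂ) : (MvPolynomial.bind₁ θ Q).totalDegree ≤ Q.totalDegree := by
  classical
  conv_lhs => rw [Q.as_sum]
  rw [map_sum]
  refine (totalDegree_finsetSum _ _).trans (Finset.sup_le fun d hd => ?_)
  rw [bind₁_monomial]
  refine (totalDegree_mul _ _).trans ?_
  rw [totalDegree_C, zero_add]
  refine (totalDegree_finsetProd _ _).trans ?_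
  calc ∑ i ∈ d.support, (θ i ^ d i).totalDegree ≤ ∑ i ∈ d.support, d i :=
        Finset.sum_le_sum fun i _ => (totalDegree_pow _ _).trans
          (by simpa using Nat.mul_le_mul_left (d i) (hθ i))
    _ ≤ Q.totalDegree := le_totalDegree hd

/-- the rank-two reduction behind (S3): if the letters factor through two letters `u, v` by a substitution `θ` of total degree ≤ 1,
✓ `rankTwoCrudeBound` bounds `nv (P(w))`. -/
theorem nv_le_of_factorsThroughTwo {m t : ℕ} (P : Poly3) (hP : P.totalDegree ≤ m) (w : Fin 3 → Poly2)
    (θ : Fin 3 → MvPolynomial (Fin 2) ℂ) (u v : Poly2) (hθ : ∀ l, (θ l).totalDegree ≤ 1)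
    (hcomp : ∀ l, aeval ![u, v] (θ l) = w l) (hu : u.support.card ≤ t) (hv : v.support.card ≤ t) :
    nv (aeval w P) ≤ constCap m t := by
  have hfun : (fun l => aeval ![u, v] (θ l)) = w := funext hcomp
  have hPw : aeval w P = aeval ![u, v] (MvPolynomial.bind₁ θ P) := by rw [aeval_bind₁, hfun]
  rw [hPw]
  exact rankTwoCrudeBound m t _ u v ((totalDegree_bind₁_le_of_le_one' θ hθ P).trans hP) hu hv

/-- (S3) CONSTANT LETTER (memo 16.5): if some letter has empty non-constant support `S1`, it is a constant (✓ `eq_C_of_S1_empty`) and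
`P(w)` is a rank-two composition of total degree ≤ m in the other two letters, bounded by ✓ `rankTwoCrudeBound`. -/
theorem nv_le_of_constLetter {m t : ℕ} (P : Poly3) (hP : P.totalDegree ≤ m) (w : Fin 3 → Poly2)
    (hw : ∀ i, (w i).support.card ≤ t) (hc : ∃ i, ¬ (S1 (w i)).Nonempty) :
    nv (aeval w P) ≤ constCap m t := by
  obtain ⟨i, hi⟩ := hc
  have hwi : w i = C (coeff 0 (w i)) := eq_C_of_S1_empty hi
  have hdC : ∀ a : ℂ, (C a : MvPolynomial (Fin 2) ℂ).totalDegree ≤ 1 := fun a => by rw [totalDegree_C]; exact zero_le_one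
  have hdX : ∀ l : Fin 2, (X l : MvPolynomial (Fin 2) ℂ).totalDegree ≤ 1 := fun l => by rw [totalDegree_X]
  have hC : ∀ (a : ℂ) (u v : Poly2), aeval ![u, v] (C a : MvPolynomial (Fin 2) ℂ) = C a := fun a u v => by
    rw [aeval_C]; rfl
  have hX0 : ∀ u v : Poly2, aeval ![u, v] (X 0 : MvPolynomial (Fin 2) ℂ) = u := fun u v => by rw [aeval_X]; rfl
  have hX1 : ∀ u v : Poly2, aeval ![u, v] (X 1 : MvPolynomial (Fin 2) ℂ) = v := fun u v => by rw [aeval_X]; rfl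
  fin_cases i
  · refine nv_le_of_factorsThroughTwo P hP w ![C (coeff 0 (w 0)), X 0, X 1] (w 1) (w 2) ?_ ?_ (hw 1) (hw 2)
    · intro l; fin_cases l
      · exact hdC _
      · exact hdX 0
      · exact hdX 1
    · intro l; fin_cases l
      · exact (hC _ _ _).trans hwi.symm
      · exact hX0 _ _
      · exact hX1 _ _
  · refine nv_le_of_factorsThroughTwo P hP w ![X 0, C (coeff 0 (w 1)), X 1] (w 0) (w 2) ?_ ?_ (hw 0) (hw 2)
    · intro l; fin_cases l
      · exact hdX 0
      · exact hdC _
      · exact hdX 1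
    · intro l; fin_cases l
      · exact hX0 _ _
      · exact (hC _ _ _).trans hwi.symm
      · exact hX1 _ _
  · refine nv_le_of_factorsThroughTwo P hP w ![X 0, X 1, C (coeff 0 (w 2))] (w 0) (w 1) ?_ ?_ (hw 0) (hw 1)
    · intro l; fin_cases l
      · exact hdX 0
      · exact hdX 1
      · exact hdC _
    · intro l; fin_cases l
      · exact hX0 _ _
      · exact hX1 _ _
      · exact (hC _ _ _).trans hwi.symm

/-! ### (C6) per-arc and per-chart counts, and the assembly -/

/-- the per-arc cap: arc-binomial ties + squared candidate count (`|supp P| ≤ (m+1)³`, ✓ `card_support_le_of_totalDegree_le`) -/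
def arcCap (m t : ℕ) : ℕ := binCap t + ((m + 1) ^ 3 * (9 * t ^ 2 + m * binCap t + 1)) ^ 2

/-- the level-one cap: two charts, `9t²` letters' ties + `(9t² + 1)` arcs each (pattern of ✓ `rankThree_nv_bound`) -/
def levelOneCap (m t : ℕ) : ℕ := 2 * (9 * t ^ 2 + (9 * t ^ 2 + 1) * arcCap m t) + 4

/-- `|cand| ≤ (m+1)³ · (9t² + m·binCap t + 1)` from (S1) and ✓ `card_support_le_of_totalDegree_le`. -/
theorem card_cand_le {σ : ℝ} (hσ : σ = 1 ∨ σ = -1) {t m : ℕ} (w : Fin 3 → Poly2) (hw : ∀ i, (w i).support.card ≤ t)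
    (hw0 : ∀ i, w i ≠ 0) (P : Poly3) (hP : P.totalDegree ≤ m) (p : Fin 3 → Expo)
    (hnc : ¬ (idet (p 0) (p 1) = 0 ∧ idet (p 0) (p 2) = 0 ∧ idet (p 1) (p 2) = 0)) :
    (cand σ w P p).card ≤ (m + 1) ^ 3 * (9 * t ^ 2 + m * binCap t + 1) := by
  unfold cand
  have hsupp := Summit.ValiantsHypothesis.ValiantsHypothesis.Theorems.TwoProducts.Negative.EscapeAccounting.card_support_le_of_totalDegree_le
    P m hP
  calc ((P.support.image (piv p)).biUnion (fun q => Tset σ (fibrePart w P p q))).card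
      ≤ ∑ q ∈ P.support.image (piv p), (Tset σ (fibrePart w P p q)).card := Finset.card_biUnion_le
    _ ≤ ∑ _q ∈ P.support.image (piv p), (9 * t ^ 2 + m * binCap t + 1) :=
        Finset.sum_le_sum (fun q _ => card_Tset_fibrePart_le hσ w hw hw0 P hP p hnc q)
    _ = (P.support.image (piv p)).card * (9 * t ^ 2 + m * binCap t + 1) := by rw [Finset.sum_const, smul_eq_mul]
    _ ≤ (m + 1) ^ 3 * (9 * t ^ 2 + m * binCap t + 1) :=
        Nat.mul_le_mul_right _ (Finset.card_image_le.trans hsupp)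

/-- `NoRayTriple` read at unique tops: the pivot triple is not a ray triple -/
theorem not_ray_of_tops {ν : Fin 2 → ℝ} {w : Fin 3 → Poly2} {p : Fin 3 → Expo} (hNR : NoRayTriple w)
    (hw : ∀ i, IsUniqueTop ν (w i) (p i)) : ¬ (idet (p 0) (p 1) = 0 ∧ idet (p 0) (p 2) = 0 ∧ idet (p 1) (p 2) = 0) :=
  hNR (p 0) (hw 0).1 (p 1) (hw 1).1 (p 2) (hw 2).1

/-- **PER-ARC COUNT**: `|Ef σ w b (P(w))| ≤ arcCap m t` under `PerDirLevelOne`, for nonzero letters. -/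
theorem card_Ef_le_of_perDir (H : PerDirLevelOne) {σ : ℝ} (hσ : σ = 1 ∨ σ = -1) {t m : ℕ} {w : Fin 3 → Poly2}
    (hw : ∀ i, (w i).support.card ≤ t) {P : Poly3} (hP : P.totalDegree ≤ m) (hNR : NoRayTriple w) (hNFC : NFC w P)
    (hw0 : ∀ i, w i ≠ 0) (b : ℕ) : (Ef σ w b (aeval w P)).card ≤ arcCap m t := by
  by_cases hE : Ef σ w b (aeval w P) = ∅
  · rw [hE]; simp
  obtain ⟨μ₀, hμ₀⟩ := Finset.nonempty_of_ne_empty hE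
  have harc0 : OnArc σ w b μ₀ := ((mem_Ef hσ).mp hμ₀).2
  have hex : ∀ i, ∃ q, IsUniqueTop (dir σ μ₀) (w i) q :=
    fun i => exists_utop3 hσ harc0.1 (hw0 i) (support_subset_S3 w i)
  choose p hp using hex
  have hcov := Ef_subset_of_perDir H hσ hP hNR hNFC hw0 b harc0 p hp
  have hnc := not_ray_of_tops hNR hp
  calc (Ef σ w b (aeval w P)).card
      ≤ (Eset σ (arcBinomial w p) ∪ coinc σ (cand σ w P p) (Ef σ w b (aeval w P))).card := Finset.card_le_card hcov
    _ ≤ (Eset σ (arcBinomial w p)).card + (coinc σ (cand σ w P p) (Ef σ w b (aeval w P))).card := Finset.card_union_le _ _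
    _ ≤ binCap t + (cand σ w P p).card * (cand σ w P p).card :=
        Nat.add_le_add (card_Eset_arcBinomial_le hσ w hw p hnc) (card_coinc_le hσ _ _)
    _ ≤ binCap t + ((m + 1) ^ 3 * (9 * t ^ 2 + m * binCap t + 1)) ^ 2 := by
        have hc := card_cand_le hσ w hw hw0 P hP p hnc
        have := Nat.mul_le_mul hc hc
        rw [sq]; omega

/-- **PER-CHART COUNT** (the split of ✓ `Eset_bound3`, verbatim pattern): `|Eset σ (P(w))| ≤ 9t² + (9t² + 1)·arcCap m t`. -/
theorem card_Eset_le_of_perDir (H : PerDirLevelOne) {σ : ℝ} (hσ : σ = 1 ∨ σ = -1) {t m : ℕ} {w : Fin 3 → Poly2}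
    (hw : ∀ i, (w i).support.card ≤ t) {P : Poly3} (hP : P.totalDegree ≤ m) (hNR : NoRayTriple w) (hNFC : NFC w P)
    (hw0 : ∀ i, w i ≠ 0) : (Eset σ (aeval w P)).card ≤ 9 * t ^ 2 + (9 * t ^ 2 + 1) * arcCap m t := by
  set D := aeval w P with hD
  have hsplit : Eset σ D ⊆ X3 σ w ∪ (Finset.range ((X3 σ w).card + 1)).biUnion (fun b => Ef σ w b D) := by
    intro μ hμ
    by_cases hX : μ ∈ X3 σ w
    · exact Finset.mem_union_left _ hX
    · apply Finset.mem_union_right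
      rw [Finset.mem_biUnion]
      exact ⟨idx3 σ w μ, Finset.mem_range.mpr (Nat.lt_succ_of_le (idx3_le σ w μ)),
        Finset.mem_filter.mpr ⟨hμ, hX, rfl⟩⟩
  have hX := card_X3_le σ hw
  have harc : ∀ b, (Ef σ w b D).card ≤ arcCap m t := fun b => card_Ef_le_of_perDir H hσ hw hP hNR hNFC hw0 b
  calc (Eset σ D).card
      ≤ (X3 σ w ∪ (Finset.range ((X3 σ w).card + 1)).biUnion (fun b => Ef σ w b D)).card := Finset.card_le_card hsplit
    _ ≤ (X3 σ w).card + ((Finset.range ((X3 σ w).card + 1)).biUnion (fun b => Ef σ w b D)).card := Finset.card_union_le _ _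
    _ ≤ (X3 σ w).card + ∑ b ∈ Finset.range ((X3 σ w).card + 1), (Ef σ w b D).card :=
        Nat.add_le_add_left Finset.card_biUnion_le _
    _ ≤ (X3 σ w).card + ∑ _b ∈ Finset.range ((X3 σ w).card + 1), arcCap m t :=
        Nat.add_le_add_left (Finset.sum_le_sum (fun b _ => harc b)) _
    _ = (X3 σ w).card + ((X3 σ w).card + 1) * arcCap m t := by rw [Finset.sum_const, Finset.card_range, smul_eq_mul]
    _ ≤ 9 * t ^ 2 + (9 * t ^ 2 + 1) * arcCap m t := by
        have := Nat.mul_le_mul_right (arcCap m t) (Nat.add_le_add_right hX 1)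
        omega

/-- **NON-CONSTANT LETTERS**: `nv (P(w)) ≤ levelOneCap m t` under `PerDirLevelOne` (✓ `nv_le` + two charts). -/
theorem nv_le_of_perDir_nonconst (H : PerDirLevelOne) {t m : ℕ} {w : Fin 3 → Poly2} (hw : ∀ i, (w i).support.card ≤ t)
    {P : Poly3} (hP : P.totalDegree ≤ m) (hNR : NoRayTriple w) (hNFC : NFC w P) (hw0 : ∀ i, w i ≠ 0) :
    nv (aeval w P) ≤ levelOneCap m t := by
  have h1 := card_Eset_le_of_perDir H (σ := 1) (Or.inl rfl) hw hP hNR hNFC hw0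
  have h2 := card_Eset_le_of_perDir H (σ := -1) (Or.inr rfl) hw hP hNR hNFC hw0
  have hn := nv_le (aeval w P)
  unfold levelOneCap
  omega

/-! ### (S4) closing arithmetic -/

/-- `x ≤ X`, `1 ≤ X`, `i ≤ j` ⇒ `x^i ≤ X^j` -/
theorem pow_le_pow_of_le {x X i j : ℕ} (h : x ≤ X) (hX : 1 ≤ X) (hij : i ≤ j) : x ^ i ≤ X ^ j :=
  (Nat.pow_le_pow_left h i).trans (Nat.pow_le_pow_right hX hij)

/-- `binCap t ≤ 23 (t+2)^6` -/
theorem binCap_le (t : ℕ) : binCap t ≤ 23 * (t + 2) ^ 6 := by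
  have hT : 1 ≤ t + 2 := by omega
  have ht : t ≤ t + 2 := by omega
  have h1 : t ^ 6 ≤ (t + 2) ^ 6 := Nat.pow_le_pow_left ht 6
  have h2 : t ^ 2 ≤ (t + 2) ^ 6 := pow_le_pow_of_le ht hT (by norm_num)
  have h3 : t ≤ (t + 2) ^ 6 := by
    have := pow_le_pow_of_le (i := 1) (j := 6) ht hT (by norm_num); simpa using this
  have h4 : 1 ≤ (t + 2) ^ 6 := Nat.one_le_pow _ _ (by omega)
  unfold binCap; omega

/-- the candidate factor `9t² + m·binCap t + 1 ≤ 33 (m+2)(t+2)^6` -/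
theorem inner_le (m t : ℕ) : 9 * t ^ 2 + m * binCap t + 1 ≤ 33 * ((m + 2) * (t + 2) ^ 6) := by
  have hT : 1 ≤ t + 2 := by omega
  have ht : t ≤ t + 2 := by omega
  have h2 : t ^ 2 ≤ (t + 2) ^ 6 := pow_le_pow_of_le ht hT (by norm_num)
  have hb := binCap_le t
  have hm : m ≤ m + 2 := by omega
  have h5 : m * binCap t ≤ (m + 2) * (23 * (t + 2) ^ 6) := Nat.mul_le_mul hm hb
  have h6 : (m + 2) * (23 * (t + 2) ^ 6) = 23 * ((m + 2) * (t + 2) ^ 6) := by ring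
  have h7 : (t + 2) ^ 6 ≤ (m + 2) * (t + 2) ^ 6 := Nat.le_mul_of_pos_left _ (by omega)
  have h8 : 1 ≤ (t + 2) ^ 6 := Nat.one_le_pow _ _ (by omega)
  rw [h6] at h5
  omega

/-- the candidate count `≤ 33 (m+2)^4 (t+2)^6` -/
theorem X_le (m t : ℕ) : (m + 1) ^ 3 * (9 * t ^ 2 + m * binCap t + 1) ≤ 33 * ((m + 2) ^ 4 * (t + 2) ^ 6) := by
  have h3 : (m + 1) ^ 3 ≤ (m + 2) ^ 3 := Nat.pow_le_pow_left (by omega) 3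
  calc (m + 1) ^ 3 * (9 * t ^ 2 + m * binCap t + 1)
      ≤ (m + 2) ^ 3 * (33 * ((m + 2) * (t + 2) ^ 6)) := Nat.mul_le_mul h3 (inner_le m t)
    _ = 33 * ((m + 2) ^ 4 * (t + 2) ^ 6) := by ring

/-- `arcCap m t ≤ 1112 (m+2)^8 (t+2)^12` -/
theorem arcCap_le (m t : ℕ) : arcCap m t ≤ 1112 * ((m + 2) ^ 8 * (t + 2) ^ 12) := by
  have hX := X_le m t
  have hX2 : ((m + 1) ^ 3 * (9 * t ^ 2 + m * binCap t + 1)) ^ 2 ≤ (33 * ((m + 2) ^ 4 * (t + 2) ^ 6)) ^ 2 :=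
    Nat.pow_le_pow_left hX 2
  have he : (33 * ((m + 2) ^ 4 * (t + 2) ^ 6)) ^ 2 = 1089 * ((m + 2) ^ 8 * (t + 2) ^ 12) := by ring
  rw [he] at hX2
  have hb := binCap_le t
  have hT : 1 ≤ t + 2 := by omega
  have h6 : (t + 2) ^ 6 ≤ (t + 2) ^ 12 := Nat.pow_le_pow_right hT (by norm_num)
  have h7 : (t + 2) ^ 12 ≤ (m + 2) ^ 8 * (t + 2) ^ 12 :=
    Nat.le_mul_of_pos_left _ (Nat.pow_pos (by omega))
  unfold arcCap; omega

/-- `levelOneCap m t ≤ 22262 (m+2)^8 (t+2)^14` -/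
theorem levelOneCap_le (m t : ℕ) : levelOneCap m t ≤ 22262 * ((m + 2) ^ 8 * (t + 2) ^ 14) := by
  have hT : 1 ≤ t + 2 := by omega
  have ht : t ≤ t + 2 := by omega
  have h2 : t ^ 2 ≤ (t + 2) ^ 2 := Nat.pow_le_pow_left ht 2
  have h1 : 1 ≤ (t + 2) ^ 2 := Nat.one_le_pow _ _ (by omega)
  have h9 : 9 * t ^ 2 + 1 ≤ 10 * (t + 2) ^ 2 := by omega
  have ha := arcCap_le m t
  have hp : (9 * t ^ 2 + 1) * arcCap m t ≤ (10 * (t + 2) ^ 2) * (1112 * ((m + 2) ^ 8 * (t + 2) ^ 12)) :=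
    Nat.mul_le_mul h9 ha
  have he : (10 * (t + 2) ^ 2) * (1112 * ((m + 2) ^ 8 * (t + 2) ^ 12)) = 11120 * ((m + 2) ^ 8 * (t + 2) ^ 14) := by ring
  rw [he] at hp
  have h14 : (t + 2) ^ 2 ≤ (t + 2) ^ 14 := Nat.pow_le_pow_right hT (by norm_num)
  have h15 : (t + 2) ^ 14 ≤ (m + 2) ^ 8 * (t + 2) ^ 14 :=
    Nat.le_mul_of_pos_left _ (Nat.pow_pos (by omega))
  unfold levelOneCap; omega

/-- (S4a) closing arithmetic for the non-constant branch -/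
theorem levelOneCap_le_pow (m t : ℕ) : levelOneCap m t ≤ (m + 2) ^ 40 * (t + 2) ^ 40 := by
  have h := levelOneCap_le m t
  have hM : 1 ≤ m + 2 := by omega
  have hT : 1 ≤ t + 2 := by omega
  have hc : 22262 ≤ (t + 2) ^ 15 := by
    have h2 : 2 ^ 15 ≤ (t + 2) ^ 15 := Nat.pow_le_pow_left (by omega) 15
    norm_num at h2; omega
  calc levelOneCap m t ≤ 22262 * ((m + 2) ^ 8 * (t + 2) ^ 14) := h
    _ ≤ (t + 2) ^ 15 * ((m + 2) ^ 8 * (t + 2) ^ 14) := Nat.mul_le_mul_right _ hc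
    _ = (m + 2) ^ 8 * (t + 2) ^ 29 := by ring
    _ ≤ (m + 2) ^ 40 * (t + 2) ^ 40 :=
        Nat.mul_le_mul (Nat.pow_le_pow_right hM (by norm_num)) (Nat.pow_le_pow_right hT (by norm_num))

/-- (S4b) closing arithmetic for the constant branch -/
theorem constCap_le_pow (m t : ℕ) : constCap m t ≤ (m + 2) ^ 40 * (t + 2) ^ 40 := by
  have hM : 1 ≤ m + 2 := by omega
  have hT : 1 ≤ t + 2 := by omega
  have ht : t ≤ t + 2 := by omega
  have h1 : t * t + t ≤ (t + 2) ^ 4 := by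
    have a : t * t ≤ (t + 2) ^ 2 := by rw [← sq]; exact Nat.pow_le_pow_left ht 2
    have b : t ≤ (t + 2) ^ 2 := by nlinarith
    have c : (t + 2) ^ 2 + (t + 2) ^ 2 ≤ (t + 2) ^ 4 := by
      have : 2 * (t + 2) ^ 2 ≤ (t + 2) ^ 2 * (t + 2) ^ 2 :=
        Nat.mul_le_mul_right _ (by nlinarith)
      rw [show (t + 2) ^ 4 = (t + 2) ^ 2 * (t + 2) ^ 2 by ring]; omega
    omega
  have h2 : (t * t) * (t * t) ≤ (t + 2) ^ 4 := by
    rw [show (t * t) * (t * t) = t ^ 4 by ring]; exact Nat.pow_le_pow_left ht 4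
  have h3 : 1 ≤ (t + 2) ^ 4 := Nat.one_le_pow _ _ (by omega)
  have hin : 3 * (t * t + t) + 2 + (t * t) * (t * t) ≤ 6 * (t + 2) ^ 4 := by omega
  have hm : m + 1 ≤ m + 2 := by omega
  have h4 : (m + 1) * (3 * (t * t + t) + 2 + (t * t) * (t * t)) ≤ (m + 2) * (6 * (t + 2) ^ 4) := Nat.mul_le_mul hm hin
  have he : (m + 2) * (6 * (t + 2) ^ 4) = 6 * ((m + 2) * (t + 2) ^ 4) := by ring
  rw [he] at h4
  have h5 : 1 ≤ (m + 2) * (t + 2) ^ 4 := h3.trans (Nat.le_mul_of_pos_left _ (by omega))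
  have h6 : constCap m t ≤ 16 * ((m + 2) * (t + 2) ^ 4) := by unfold constCap; omega
  have hc : 16 ≤ (t + 2) ^ 4 := by
    have h2' : 2 ^ 4 ≤ (t + 2) ^ 4 := Nat.pow_le_pow_left (by omega) 4
    norm_num at h2'; omega
  calc constCap m t ≤ 16 * ((m + 2) * (t + 2) ^ 4) := h6
    _ ≤ (t + 2) ^ 4 * ((m + 2) * (t + 2) ^ 4) := Nat.mul_le_mul_right _ hc
    _ = (m + 2) ^ 1 * (t + 2) ^ 8 := by ring
    _ ≤ (m + 2) ^ 40 * (t + 2) ^ 40 :=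
        Nat.mul_le_mul (Nat.pow_le_pow_right hM (by norm_num)) (Nat.pow_le_pow_right hT (by norm_num))


/-- a letter with nonempty non-constant support is nonzero -/
theorem ne_zero_of_S1_nonempty {u : Poly2} (h : (S1 u).Nonempty) : u ≠ 0 := by
  rintro rfl
  obtain ⟨s, hs⟩ := h
  have := (mem_S1.mp hs).1
  simp at this

/-- ★★ **TRANCHE C ASSEMBLY**: `LevelOneLaw ⟸ PerDirLevelOne` (exponent `c = 40`; memo §16). -/
theorem levelOneLaw_of_perDir (H : PerDirLevelOne) : LevelOneLaw := by
  refine ⟨40, fun m t P w hP hw hNR hNFC => ?_⟩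
  by_cases hc : ∃ i, ¬ (S1 (w i)).Nonempty
  · exact (nv_le_of_constLetter P hP w hw hc).trans (constCap_le_pow m t)
  · push Not at hc
    have hw0 : ∀ i, w i ≠ 0 := fun i => ne_zero_of_S1_nonempty (hc i)
    exact (nv_le_of_perDir_nonconst H hw hP hNR hNFC hw0).trans (levelOneCap_le_pow m t)

/--
info: 'Summit.ValiantsHypothesis.ValiantsHypothesis.Cruxes.TwoProducts.ValIdea35g11Lattice.Ef_subset_of_perDir' depends on axioms: [propext,
 Classical.choice,
 Quot.sound]
-/
#guard_msgs in
#print axioms Ef_subset_of_perDir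

/--
info: 'Summit.ValiantsHypothesis.ValiantsHypothesis.Cruxes.TwoProducts.ValIdea35g11Lattice.levelOneLaw_of_perDir' depends on axioms: [propext,
 Classical.choice,
 Quot.sound]
-/
#guard_msgs in
#print axioms levelOneLaw_of_perDir

end TrancheC

section ClosureB203
/-! ### ★★★ CLOSURE (REV 3): TRANCHE A (imported main workfile) ⧺ TRANCHE B ⧺ TRANCHE C -/
open scoped Classical
open Summit.ValiantsHypothesis.ValiantsHypothesis.Theorems.TwoProducts.RankTwoJacobian (IsUniqueTop IsEdgeDir wt)

/-- ★★★ `PerDirLevelOne` HOLDS: the main file's per-direction level-1 top theorem `ValIdea35g10.levelOne_not_isEdgeDir` (TRANCHE A) fed with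
the progression data of ★★ `exists_progData` (TRANCHE B) at `cp := zpos (genRel p)`, `cm := zneg (genRel p)`, `J := m`, `hrel := piv_zpos_eq`,
and with the arc binomial's unique top from `ValIdea35g10.exists_isUniqueTop_of_not_isEdgeDir` (or the zero branch).  Verbatim the HOME rev9
glue `levelOne_not_isEdgeDir_nc`; the two vocabularies agree definitionally (crit-8 T-c, 29 `rfl`). -/
theorem perDirLevelOne_holds : PerDirLevelOne := by
  intro ν w P p m hP hNR hw hN hNFC hgen
  have hnc := not_ray_of_tops hNR hw
  obtain ⟨base, idx, hidx, hprog⟩ := exists_progData P m hP p hnc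
  have hrel : piv p (zpos (genRel p)) = piv p (zneg (genRel p)) := piv_zpos_eq p (genRel_spec p hnc).1
  by_cases hN0 : arcBinomial w p = 0
  · exact ValIdea35g10.levelOne_not_isEdgeDir w P p hw (zpos (genRel p)) (zneg (genRel p)) m base idx hrel hidx hprog 0
      (Or.inl hN0) hNFC hgen
  · obtain ⟨E, hE⟩ := ValIdea35g10.exists_isUniqueTop_of_not_isEdgeDir hN0 hN
    exact ValIdea35g10.levelOne_not_isEdgeDir w P p hw (zpos (genRel p)) (zneg (genRel p)) m base idx hrel hidx hprog E
      (Or.inr hE) hNFC hgen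

/-- ★★★ `LevelOneLaw` (this file's verbatim copy of the main file's typed-OPEN statement) HOLDS, unconditionally. -/
theorem levelOneLaw_holds : LevelOneLaw := levelOneLaw_of_perDir perDirLevelOne_holds

/-- the copy IS the main workfile's `LevelOneLaw`, definitionally (crit-8 #105/#106 dictionary check T-c). -/
theorem levelOneLaw_eq_main : LevelOneLaw = ValIdea35g10.LevelOneLaw := rfl

/-- ★★★ the main workfile's typed-OPEN `ValIdea35g10.LevelOneLaw` — CLOSED. -/
theorem main_levelOneLaw : ValIdea35g10.LevelOneLaw := levelOneLaw_eq_main ▸ levelOneLaw_holds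

/--
info: 'Summit.ValiantsHypothesis.ValiantsHypothesis.Cruxes.TwoProducts.ValIdea35g11Lattice.main_levelOneLaw' depends on axioms: [propext,
 Classical.choice,
 Quot.sound]
-/
#guard_msgs in
#print axioms main_levelOneLaw

end ClosureB203

end Summit.ValiantsHypothesis.ValiantsHypothesis.Cruxes.TwoProducts.ValIdea35g11Lattice
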